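import Summits.AtomisticToContinuum.Crystallization.Theses.ThreeConeCertificate
import Summits.AtomisticToContinuum.Crystallization.Theorems.ChargedEnergyGap.Negative.BlocksBound
import Summits.AtomisticToContinuum.Crystallization.Theorems.ChargedEnergyGap.Negative.Periodisation

/-!
# Disproof of `ExactCertificate` (item stmt-AtomisticToContinuum-11959) — work file, cycle 2 (rev 9)

Standing adversary (`cdisprove`, refuter lineage) on the crux
`ThreeConeCertificate.ExactCertificate` (shared with `BraggSlacknessRigidity.ExactCertificate`,
gen-1 twin `CrystalThreeCone.ExactCertificate` = old item 3100):

`∃ P ρ c g U f, (S1) V_LJ = g + U + f on (0,∞) ∧ (S2) U ≥ 0 on (0,∞) ∧ (S3) g ≡ 0 on [ρ,∞) ∧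
 (S4) f radially of positive type on ℝ³ (all finite quadratic forms, diagonal = f 0) ∧
 (S5) g is c-stable on finite injective configurations ∧ (S6) c + f 0 / 2 = −e_LJ(P)`.

VERDICT (cycle 2): **resists** — no kill; it is an open-problem-level existence statement whose
negation needs either a duality-gap theorem for the three-cone bound at EVERY finite range `ρ`
(`exactAt_mono`: witnesses are monotone in `ρ`, so a kill must work at arbitrarily large ranges)
or the failure of the energetic crystallization conjecture itself (`keplerBound_iff_conjunct_i`).
Everything below is `sorry`-free.

LANDED / FILED COMPANIONS (importable; namespace `…Theorems.ExactCertificateNegative`, directory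
`Theorems/ExactCertificate/Negative/`): `SplitBasics` (p83812 ACCEPTED @ad8ddc363bb7: `IsSplit` + §1 incl.
the value floor) · `LoadBearing` (p100289, review; its eight `Without…/Feasible…` Props were relocated by
the gate to `Literature/Uncategorized/WithoutPosType.lean`, p99783) · `NormalForm` (p102312, review: §2
normal form, ranges, competitors).  The line lead re-landed §2/§4 against `SplitBasics` as
`Theorems/ThreeConeCertificateExactCertificateSlackness{Blocks,Energy}.lean` (namespace
`…ThreeConeCertificateExactCertificate.Slackness`: `witness_eq`, `slacks_le`, `U_eq_zero_of_mem_points`,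
`f_eq_lennardJones_of_mem_points`, `energyPerParticle_g_eq`, `f_zero_add_two_mul_energyPerParticle_f`, …,
plus `const_le_energyPerParticle_of_stable`), `…NoGapNecessary/NoGapIff.lean` (the factorisation) and
`ThreeConeCertificateKeplerBound.lean` (`keplerBound_iff_hasPeriodicGroundStateEnergy`); importers should
use those tree files — this work file stays self-contained.

## Findings (Lean-certified here)

* §0 `exactCertificate_iff` — the crux is `∃ P ρ c g U f, IsSplit ρ c g U f ∧ c + f 0/2 = −e(P)`
  with `IsSplit` = (S1)–(S5).  NORMAL FORM `exactCertificate_iff_single` (end of §2): the crux is a statement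
  about ONE radial function — `∃ P ρ f, f of positive type ∧ f ≤ V_LJ on [ρ,∞) ∧ (V_LJ − f)·1_{(0,ρ)} is
  (−e(P) − f 0/2)-stable` (`U` may be taken `0` below `ρ`; `g, U, c` are then determined by `f`);
  `kappa_le_of_single`: any stability constant of `(V_LJ − f)1_{(0,ρ)}` is `≤ e* + f 0/2`.
* §1 NECESSARY CONDITIONS ON ANY SPLIT (S1)–(S5), no `P` involved: `c ≥ 0` (N = 1), `f 0 ≥ 0`,
  `|f r| ≤ f 0` (n = 1, 2), `f = V_LJ − U ≤ V_LJ` on `[ρ,∞) ∩ (0,∞)` hence `0 < f 0`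
  (THE BOCHNER CONE IS NECESSARILY CHARGED: no `f ≡ 0` witness, `not_exact_with_f_zero_eq_zero`),
  `−V_LJ(r) ≤ f 0` for `r ≥ ρ`, the finite-N bound `−(c + f 0/2)·N ≤ E_LJ(x)` for every
  injective `x` (`IsSplit.kepler`, = the CertificateBound mechanism), the many-point Bochner budget
  `−2·E_LJ(y) ≤ n·f 0` for every injective `y` with all pair distances `≥ ρ`
  (`IsSplit.binding_le`), and **THE VALUE FLOOR `−e* ≤ c + f 0/2`** (`IsSplit.value_ge`,
  `e* = ⨅_Q e_LJ(Q)`; by the tree's trial states `exists_trialState`): no three-cone split at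
  any range beats the periodic infimum — the `=` in (S6) can only be attained from above.
* §2 CONSEQUENCES FOR A WITNESS: `e(P) = e*` and `c + f 0/2 = −e*` (`witness_eq`), `P` is a
  periodic minimiser (`isLeast_of_witness`), and **`ExactCertificate → conjunct (i)`**
  (`hasPeriodicGroundStateEnergy_of_exactCertificate`, with `E(N)/N → e*` re-derived here as
  `tendsto_div_eStar`).  FACTORISATION `exactCertificate_iff_sharp_and_attained`:
  `ExactCertificate ↔ SharpSplit ∧ PeriodicMinimiser`, where `SharpSplit` (some split has value
  `≤ −e*`, equivalently `= −e*`) does not mention `P` at all, and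
  `PeriodicMinimiser ↔ KeplerBound ↔ HasPeriodicGroundStateEnergy V_LJ 3`
  (`keplerBound_iff_periodicMinimiser`, `keplerBound_iff_conjunct_i`).  So the crux = (the
  attained-minimum half of conjunct (i)) ∧ (no duality gap for the three-cone bound); the route's
  support items KeplerBound (11961), TrialStateUpper (11963, `trialStateUpper_holds`),
  CertificateBound (11962), EnergeticHalf (11964) are all provable now or equivalent to (i).
  `exactCertificate_iff_le`: replacing `=` by `≤ −e(P)` in (S6) gives the same statement.
* §3 LOAD-BEARING ANALYSIS (one hypothesis dropped at a time; the crux is existential, so a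
  dropped constraint makes it WEAKER — the finding is which drops make it trivial):
  (S4) dropped ⇒ TRUE trivially for every `P` (`withoutPosType_trivial`: `f := V_LJ` off `0`,
  `f 0 := −2e(P)`); (S2) dropped ⇒ TRUE trivially (`withoutUNonneg_trivial`: constant
  `f ≡ −2e(Q) ≥ 0` at a periodic `Q` with `e(Q) < 0`, `U := V − f`); (S1) dropped ⇒ TRUE trivially
  (`withoutSplit_trivial`); (S3) dropped ⇒ EXACTLY KeplerBound ⇔ conjunct (i)'s attained minimum
  (`withoutFiniteRange_iff_keplerBound`: `g := V_LJ` swallows everything) — finite range is what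
  separates the crux from conjunct (i); (S5) dropped or (S6) dropped ⇒ EXACTLY bare feasibility of
  the cone split (`withoutStability_iff_feasible`, `withoutEquation_iff_feasibleStable`), a
  statement of real analysis: it needs a radial positive-type `f` on `ℝ³` with `f ≤ V_LJ < 0` on a
  neighbourhood of infinity (`Feasible.tail`).  ON PAPER such `f` exist: `F(r) = (5 − r²)/(1 + r²)⁴`
  is the 3-D Fourier transform of `(16π)⁻¹(1 + |k| + |k|²/2)e^{−|k|} ≥ 0` (hand computation:
  `(4π/r)∫₀^∞ (t + t² + t³/2)e^{−t} sin(rt) dt = 16π(5 − r²)/(1 + r²)⁴`), so `F` is of positive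
  type with `F(r) ∼ −r⁻⁶`, and `α·F(r/λ) ≤ V_LJ(r)` on `[R,∞)` once `αλ⁶ > 1/6`; NOT formalised
  (3-D Fourier inversion), so `Feasible` is left as a named hypothesis, never as an axiom.
* §4 TIGHTNESS ALONG `P`-BLOCKS (complementary slackness, from the tree's block trial states
  `Blocks.exists_block_energy_le`): for a witness, the three slacks of the `K`-blocks of `P` —
  `E_g + c·N`, `E_U`, `E_f + N·f 0/2`, each `≥ 0` — are eventually `≤ ε·N` (`slacks_le`);
  by pair counting in blocks (`sub_mul_le_two_mul_energy`: a distance of `P` is realised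
  `≥ K³ − 6MK²` times in the `K`-block) **`U = 0` on `D_P ∩ [ρ,∞)`** (`U_eq_zero_of_mem_points`)
  and **`f = V_LJ` on `D_P ∩ [ρ,∞)`** (`f_eq_lennardJones_of_mem_points`: one-sided contact
  `f ≤ V_LJ` on the tail with equality on the distance set); by the block energy identity for
  finite-range potentials (`abs_two_mul_energy_block_sub_le`: `|2E_W(block_K) − 2N_K e_W(P)| ≤
  C·K²`) **`e_g(P) = −c`** (`energyPerParticle_g_eq`: `P` is an exact per-particle ground state of
  `g`, whose stability constant is attained by a periodic configuration), **`e_U(P) = 0`**, the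
  periodic energy splits `e(P) = e_g + e_U + e_f` (`energyPerParticle_split`, all three lattice
  sums convergent) and **`f 0 + 2e_f(P) = 0`** (`f_zero_add_two_mul_energyPerParticle_f`: the
  `P`-sum of `f` including the self-term vanishes — `∫f = 0` and `𝓕f·|S_P|² = 0` on the reciprocal
  lattice in Fourier language).  So the planner's informal "triple complementary slackness" is now
  a set of Lean theorems about every witness; `c_eq_zero_of_range_le_minDist`: a range below the
  minimal distance of `P` forces `c = 0` (the finite-range cone is idle; intended witnesses need
  `ρ > d_min(P) ≈ 0.97`); COMPETITORS: for every periodic `Q` the three slacks of its blocks are bounded by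
  its excess energy `e(Q) − e*` (`slacks_le_of_periodic`, `f_slack_le_of_periodic`) and
  `e_g(Q) + c ≤ e(Q) − e*` (`g_excess_le_of_periodic`) — the rigorous core of the "Barlow squeeze"
  (heuristic, module docstring below): near-degenerate stackings (`e(Q) − e* ∼ 10⁻⁴`) force `𝓕f` to be
  `10⁻⁴`-small on all stacking rods, i.e. `f` band-limited to `|k| ≲ 4π/(√3 a)` up to `10⁻⁴`; and
  for a witness with `ρ ≤ 0` (two-cone, `g ≡ 0` on `(0,∞)`) `c = 0` and `f 0/2 = −e*`
  (`c_eq_zero_of_rho_nonpos`): the `ρ ≤ 0` sub-case is EXACTLY sharpness of the Fisher–Ruelle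
  two-cone bound for Lennard-Jones (believed false — LP duality gap — but a Lean refutation needs
  `e*` from above to better than the gap, i.e. `B_LJ ≤ (1+gap)·8.61ε` against the tree's `14.3ε`).
* §5 STRENGTHENINGS / VARIANTS REFUTED: `not_exact_with_f_zero_eq_zero` (no witness with
  `f 0 = 0`, in particular none with `f ≡ 0`: the `ρ = ∞` collapse "g = V_LJ, U = f = 0" is not
  available at any real `ρ`); `not_exact_with_c_neg` (no witness with `c < 0`);
  `exactAt_mono` (up-set in `ρ`).

## The Barlow squeeze (heuristic, numbers uncertified)

With a witness, every Barlow polytype `σ` has `f`-slack `≤ e(σ) − e(hcp) ∼ 10⁻⁴…10⁻⁵` per particle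
(`f_slack_le_of_periodic`), i.e. `Σ_{G ∈ Λ_σ^*} 𝓕f(|G|)|S_σ(G)|²` is `10⁻⁴`-small; the stacking-dependent
peaks of the polytypes (and the diffuse rods of random stackings, `e − e* ≈ |J₂|/2`) cover every sphere
`|k| = s ≥ 4π/(√3 a) ≈ 7.5`, so `𝓕f` carries `≲ 10⁻⁴` of its mass beyond `7.5`: `f = f_BL + f_ε` with
`f_BL` band-limited (cannot vary on scales `< 2π/7.5 ≈ 0.84`) and `sup|f_ε| ≲ 10⁻⁴`.  Meanwhile `f` touches
`V_LJ` from below at the hcp distances beyond `ρ` (spacing `≈ 0.03–0.3`): so `f_BL` tracks `V_LJ` within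
`10⁻⁴` on `[max ρ 2, ∞)` and `f_ε` makes the contacts.  Self-consistent at the `10⁻⁴` level (no contradiction:
`V_LJ` beyond `2.5` has local bandwidth `6/r < 7.5`), but it says WHERE a witness lives: `𝓕f ≥ 0` supported
essentially in `|k| ≤ 7.5` with `𝓕f(0) = 0`, the `−(π²/72)|k|³` cusp dictated by the `−r⁻⁶/6` tail, total
mass `f(0) = 2|e*| ≈ 1.44`, and all the fine interpolation done by a `10⁻⁴`-budget high-frequency part.

## The one-dimensional analogue (paper reduction) and the numerics (kit jobs, 2026-08-16)

In `d = 1` (ground state `a⋆ℤ`, `a⋆⁶ = ζ(12)/ζ(6)`, `e⋆ = −ζ(6)²/(12ζ(12)) ≈ −0.0862277`) the tail conditions of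
a witness with template `P = a⋆ℤ` solve in closed form: the zero `P`-sum forces `𝓕f` to vanish to second order on
`2πℤ/a⋆`, i.e. `f = 2Ψ − Ψ(· − a⋆) − Ψ(· + a⋆)` with `Ψ` positive definite (then `Σ_ℤ f(na⋆) = 0` telescopes),
and contact `f = V` on `a⋆ℤ ∩ [ρ,∞)` pins `Ψ(na⋆) = −Σ_{j>n}(j − n)V(ja⋆) > 0` (decreasing, convex — Pólya-type
data) and `Ψ'(na⋆)`; what remains is `V + Δ_{a⋆}Ψ ≥ 0` off the lattice on `[ρ,∞)` and `x = a⋆` minimising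
`g = V + Δ_{a⋆}Ψ` on `(0,ρ)` — no visible obstruction.

* **1-D THREE-CONE LP** (`j013835`, evidence on the item; primal LP `min c + f(0)/2`, `f` = signed Gaussian
  mixture + fat-tailed positive-type elements, `𝓕f ≥ 0` on a `k`-grid, `f ≤ V` on `[ρ,40]`, stability of
  `(V − f)1_{(0,ρ)}` against periodic chains found by a cutting-plane oracle, cells `≤ 5`):
  `ρ = 1.5` (20 Gaussians): value `0.08622788` against `−e⋆ = 0.08622769`, gap `+1.9·10⁻⁷`, CONVERGED (oracle
  finds nothing), and the residual equals the loss of the imposed tail margin `(1+10⁻⁴)/6` (`≈ 2.9·10⁻⁷`):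
  **the three-cone bound is SHARP at finite range `ρ = 1.5a⋆` in `d = 1` to `< 10⁻⁷`** (`c = 0.0524`,
  `f(0)/2 = 0.0338`); and the optimum DISPLAYS the complementary slackness of §4 numerically: contacts
  `(V − f)(na⋆) ∈ [3·10⁻¹², 10⁻⁷]` for `n = 2…7`, Bragg zeros `𝓕f(2πm/a⋆) ∈ [10⁻¹⁶, 2·10⁻⁸]` for `m = 0…4`,
  `argmin g = 0.997 = a⋆` with `min g = e_g(a⋆ℤ) = −c`, and the LP dual is the genuine chain at spacing
  `0.9972` with weight `1.000` (no phantom).  `ρ = 2.5` (30 Gaussians): value `= −e⋆ − 6·10⁻⁶` (below the PROVEN floor ⇒ oracle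
  leakage `∼10⁻⁸`/round and a-posteriori grid violations `2·10⁻⁶` (PD) / `9·10⁻⁶` (tail); i.e. sharp within
  `10⁻⁵`).  Richer bases (60, 90) are ill-conditioned (values
  `10⁻³` below the floor with persistent `10⁻⁵` violations) and are to be ignored.  VERDICT: the 1-D analogue of
  `ExactCertificate` is numerically TRUE — the three-cone form is not intrinsically gapped; the 3-D difficulty is
  3-D (dense distance/Bragg sets, stacking degeneracy, local polytetrahedral order), not the certificate shape.
* **3-D TAIL-INTERPOLANT RELAXATION** (`j009698`; hcp template, `a⋆ = 0.9712`): minimise the contact defect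
  `τ = max_{d ∈ D_hcp ∩ [ρ,6]}(V − f)(d)` over radial `𝓕f ≥ 0` supported in `|k| ≤ K_cut` with zeros at the
  non-extinct hcp Bragg radii, `f ≤ V` on `[ρ,10]`, zero `P`-sum, `f(0) ≤ 2|e(hcp)|`: `τ⋆ ≈ 0` (`≤ 3·10⁻⁶`,
  mostly `≤ 10⁻⁹`) for ALL `ρ ∈ {1.8, 2.5, 3.2}` and `K_cut ∈ {7.4, 12, 18, 26}` — even band-limited below the
  first Bragg rod; the LP simply makes `f ≈ V` on whole stretches of the tail, with `f(0)` anywhere in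
  `[0.03, 1.44]`.  So the tail/Bochner conditions (contact on `D_P`, `f ≤ V`, zero `P`-sum, positivity) are NO
  obstruction by themselves: **all the content of the crux sits in the stability of `g = (V − f)1_{(0,ρ)}`**.
* **3-D VALUE LP** (`j014177`; Schoenberg basis `f = Σ s_n sinc(k_n r)`, `s ≥ 0`, atoms to `k = 400`;
  stability of `(V − f)1_{(0,ρ)}` only against 26 periodic families (hcp with 12 values of `c/a`, fcc, dhcp,
  6H, 9R, bcc, sc, diamond, A15, simple hexagonal), 2-D nets, the chain and 7 clusters over scale scans):
  `v_LP = 0.669 (ρ = 2.5), 0.686 (1.8), 0.595 (3.5), 0.458 (5.0)` — all BELOW the proven floor `−e⋆ ≈ 0.7176`,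
  i.e. the primal is grossly under-constrained: the LP carves `g` to exploit every structure missing from the
  family (binding rows: hcp/fcc near `a⋆`, the centred icosahedron `ico13`, 9R, A15, the triangular net).
  Dual phantoms from these runs certify only `v(ρ) ≥ 0.43–0.49` (their structure factors dip to `−0.4…−0.8`
  between `k`-atoms).  LESSON for 11958/11959: a meaningful 3-D three-cone value needs a genuine
  structure-search separation oracle (periodic cells + clusters re-optimised against each LP iterate) — i.e.
  certifying `c(g)` is the Kepler-hard core, exactly as the planner's `why it might fail` says; and
  polytetrahedral (icosahedral) local order is an ACTIVE competitor at `ρ = 2.5–3.5`.  Not pursued further by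
  the disprover (it can bound 11958, it cannot decide 11959).

## Why it resists (read before trying to kill it)

By §2 a kill is `¬SharpSplit ∨ ¬PeriodicMinimiser`.  `¬PeriodicMinimiser` = the periodic infimum
of `e_LJ` is not attained (aperiodic optimal stacking / no minimiser) — the negation of half the
summit, hopeless and probably false.  `¬SharpSplit` = a duality gap for the three-cone programme
at EVERY finite range: by `exactAt_mono` gaps certified at `ρ ≤ 5/2` (the planner's NoGap numerics,
≥ 1 %) say nothing about large `ρ`, and as `ρ → ∞` the programme tends to KeplerBound itself
(`withoutFiniteRange_iff_keplerBound`), so the gap, if any, closes in the limit and a structural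
obstruction would have to hold uniformly in `ρ` — e.g. "no positive-type radial `f` has
`f ≤ V_LJ` on `[ρ,∞)` with equality on `D_P ∩ [ρ,∞)` and vanishing `P`-sum" for every `ρ`, which
is a statement about one-sided Bochner interpolation at the tail of `D_hcp` that nobody can
decide (Cohn–Kumar-type; only `d ∈ {8, 24}` instances exist).  Quantitative Lean kills are out of
reach for the same reason as for every energetic crux here: `e*` is known from above only through
explicit trial states and from below only to `−2³²/12` (tree) / `−1.19` (Yuhjtman), against
`e* ≈ −0.7176`.
-/

noncomputable section

namespace Summit.AtomisticToContinuum.Crystallization.Cruxes.ExactCertificate.Disproof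

open Literature.MathematicalPhysics.StatisticalMechanics
open Summit.AtomisticToContinuum.Crystallization.Theses.ThreeConeCertificate
open Summit.AtomisticToContinuum.Crystallization.Theorems.ChargedEnergyGapNegative
  (eStar card_mul_eStar_le_interactionEnergy bddBelow_energyPerParticle_lennardJones
    exists_trialState eStar_le le_energyPerParticle_of_tendsto)
open Filter Topology
open scoped BigOperators

/-! ## §0. The crux, parametrised -/

/-- Ambient space `ℝ³`. -/
abbrev E3 : Type := EuclideanSpace ℝ (Fin 3)

/-- The five cone conditions (S1)–(S5) on a split `(ρ, c, g, U, f)` of the Lennard-Jones potential: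
everything in the crux except the periodic configuration and the value equation (S6). -/
def IsSplit (ρ c : ℝ) (g U f : ℝ → ℝ) : Prop :=
  (∀ r : ℝ, 0 < r → lennardJones r = g r + U r + f r) ∧
  (∀ r : ℝ, 0 < r → 0 ≤ U r) ∧
  (∀ r : ℝ, ρ ≤ r → g r = 0) ∧
  (∀ (n : ℕ) (y : Fin n → E3) (w : Fin n → ℝ), 0 ≤ ∑ i, ∑ j, w i * w j * f (dist (y i) (y j))) ∧
  (∀ (N : ℕ) (x : Fin N → E3), Function.Injective x → -(c * (N : ℝ)) ≤ interactionEnergy g x)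

/-- The crux at a GIVEN range `ρ`. -/
def ExactAt (ρ : ℝ) : Prop :=
  ∃ (P : PeriodicConfiguration 3) (c : ℝ) (g U f : ℝ → ℝ),
    IsSplit ρ c g U f ∧ c + f 0 / 2 = -(P.energyPerParticle lennardJones)

/-- `ExactCertificate ↔ ∃ P ρ c g U f, IsSplit ρ c g U f ∧ c + f 0 / 2 = −e(P)`. -/
theorem exactCertificate_iff :
    ExactCertificate ↔ ∃ (P : PeriodicConfiguration 3) (ρ c : ℝ) (g U f : ℝ → ℝ),
      IsSplit ρ c g U f ∧ c + f 0 / 2 = -(P.energyPerParticle lennardJones) := by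
  constructor
  · rintro ⟨P, ρ, c, g, U, f, h1, h2, h3, h4, h5, h6⟩
    exact ⟨P, ρ, c, g, U, f, ⟨h1, h2, h3, h4, h5⟩, h6⟩
  · rintro ⟨P, ρ, c, g, U, f, ⟨h1, h2, h3, h4, h5⟩, h6⟩
    exact ⟨P, ρ, c, g, U, f, h1, h2, h3, h4, h5, h6⟩

/-- `ExactCertificate ↔ ∃ ρ, ExactAt ρ`. -/
theorem exactCertificate_iff_exists_exactAt : ExactCertificate ↔ ∃ ρ, ExactAt ρ := by
  rw [exactCertificate_iff]
  constructor
  · rintro ⟨P, ρ, c, g, U, f, h, h6⟩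
    exact ⟨ρ, P, c, g, U, f, h, h6⟩
  · rintro ⟨ρ, P, c, g, U, f, h, h6⟩
    exact ⟨P, ρ, c, g, U, f, h, h6⟩

/-! ## §1. Necessary conditions on any split (no periodic configuration involved) -/

/-- The point `t·e₀` on the first axis. -/
def ax (t : ℝ) : E3 := EuclideanSpace.single 0 t

theorem dist_ax (s t : ℝ) : dist (ax s) (ax t) = |s - t| := by
  rw [← Real.dist_eq]
  simp [ax]

/-- The full double sum of a radial kernel splits into diagonal and twice the pair energy. -/
theorem sum_sum_eq (F : ℝ → ℝ) {N : ℕ} (x : Fin N → E3) :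
    ∑ i, ∑ j, F (dist (x i) (x j)) = N * F 0 + 2 * interactionEnergy F x := by
  rw [two_mul_interactionEnergy]
  have h : ∀ i : Fin N, ∑ j, F (dist (x i) (x j)) = F 0 + siteEnergy F x i := fun i => by
    rw [siteEnergy, ← Finset.add_sum_erase Finset.univ _ (Finset.mem_univ i), dist_self]
  simp only [h, Finset.sum_add_distrib, Finset.sum_const, Finset.card_univ, Fintype.card_fin,
    nsmul_eq_mul]

/-- The interaction energy is additive in the potential. -/
theorem interactionEnergy_add (V W : ℝ → ℝ) {N : ℕ} (x : Fin N → E3) :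
    interactionEnergy (fun r => V r + W r) x = interactionEnergy V x + interactionEnergy W x := by
  simp only [interactionEnergy, Finset.sum_add_distrib]

/-- Two potentials that agree on `(0,∞)` have the same energy on injective configurations. -/
theorem interactionEnergy_congr_pos {V W : ℝ → ℝ} (h : ∀ r, 0 < r → V r = W r) {N : ℕ}
    {x : Fin N → E3} (hx : Function.Injective x) :
    interactionEnergy V x = interactionEnergy W x := by
  unfold interactionEnergy
  refine Finset.sum_congr rfl fun i _ => Finset.sum_congr rfl fun j hj => h _ ?_
  exact dist_pos.2 fun heq => (Finset.mem_Ioi.1 hj).ne' (hx heq.symm)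

/-- A potential non-negative on `(0,∞)` has non-negative energy on injective configurations. -/
theorem interactionEnergy_nonneg_of_pos {V : ℝ → ℝ} (h : ∀ r, 0 < r → 0 ≤ V r) {N : ℕ}
    {x : Fin N → E3} (hx : Function.Injective x) : 0 ≤ interactionEnergy V x := by
  unfold interactionEnergy
  refine Finset.sum_nonneg fun i _ => Finset.sum_nonneg fun j hj => h _ ?_
  exact dist_pos.2 fun heq => (Finset.mem_Ioi.1 hj).ne' (hx heq.symm)

namespace IsSplit

variable {ρ c : ℝ} {g U f : ℝ → ℝ}

theorem split (h : IsSplit ρ c g U f) : ∀ r, 0 < r → lennardJones r = g r + U r + f r := h.1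
theorem U_nonneg (h : IsSplit ρ c g U f) : ∀ r, 0 < r → 0 ≤ U r := h.2.1
theorem g_zero (h : IsSplit ρ c g U f) : ∀ r, ρ ≤ r → g r = 0 := h.2.2.1
theorem posType (h : IsSplit ρ c g U f) :
    ∀ (n : ℕ) (y : Fin n → E3) (w : Fin n → ℝ), 0 ≤ ∑ i, ∑ j, w i * w j * f (dist (y i) (y j)) :=
  h.2.2.2.1
theorem stable (h : IsSplit ρ c g U f) :
    ∀ (N : ℕ) (x : Fin N → E3), Function.Injective x → -(c * (N : ℝ)) ≤ interactionEnergy g x :=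
  h.2.2.2.2

/-- Monotonicity in the range: a split of range `ρ` is a split of every larger range. -/
theorem mono (h : IsSplit ρ c g U f) {ρ' : ℝ} (hρ : ρ ≤ ρ') : IsSplit ρ' c g U f :=
  ⟨h.1, h.2.1, fun r hr => h.g_zero r (hρ.trans hr), h.2.2.2.1, h.2.2.2.2⟩

/-- (N = 1) **`c ≥ 0`**: a single particle has zero `g`-energy. -/
theorem c_nonneg (h : IsSplit ρ c g U f) : 0 ≤ c := by
  have h1 := h.stable 1 (fun _ => 0) (fun i j _ => Subsingleton.elim i j)
  rw [interactionEnergy_of_subsingleton] at h1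
  simpa using h1

/-- (n = 1) **`f 0 ≥ 0`**. -/
theorem f_zero_nonneg (h : IsSplit ρ c g U f) : 0 ≤ f 0 := by
  have h1 := h.posType 1 (fun _ => 0) (fun _ => 1)
  simpa using h1

/-- The two-point quadratic form. -/
theorem quad_two (f : ℝ → ℝ) (r s : ℝ) :
    ∑ i : Fin 2, ∑ j : Fin 2, (![1, s] i) * (![1, s] j) * f (dist ((![ax 0, ax r]) i) ((![ax 0, ax r]) j))
      = (1 + s ^ 2) * f 0 + 2 * s * f |r| := by
  simp only [Fin.sum_univ_two, Matrix.cons_val_zero, Matrix.cons_val_one,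
    dist_self, dist_ax, zero_sub, sub_zero, abs_neg]
  ring

/-- (n = 2) **`|f r| ≤ f 0`** for `r ≥ 0`. -/
theorem abs_f_le (h : IsSplit ρ c g U f) {r : ℝ} (hr : 0 ≤ r) : |f r| ≤ f 0 := by
  have h1 := h.posType 2 ![ax 0, ax r] ![1, 1]
  have h2 := h.posType 2 ![ax 0, ax r] ![1, -1]
  rw [quad_two, abs_of_nonneg hr] at h1 h2
  rw [abs_le]
  constructor <;> nlinarith

/-- On the tail `[ρ,∞) ∩ (0,∞)`: `f = V_LJ − U`. -/
theorem f_eq_tail (h : IsSplit ρ c g U f) {r : ℝ} (hρ : ρ ≤ r) (hr : 0 < r) :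
    f r = lennardJones r - U r := by
  have h1 := h.split r hr
  rw [h.g_zero r hρ] at h1
  linarith

/-- On the tail: **`f ≤ V_LJ`** (one-sided interpolation from below is forced). -/
theorem f_le_tail (h : IsSplit ρ c g U f) {r : ℝ} (hρ : ρ ≤ r) (hr : 0 < r) :
    f r ≤ lennardJones r := by
  have h1 := h.f_eq_tail hρ hr
  have h2 := h.U_nonneg r hr
  linarith

/-- Hence **`−V_LJ(r) ≤ f 0`** for every `r ≥ ρ`, `r > 0`. -/
theorem neg_lennardJones_le_f_zero (h : IsSplit ρ c g U f) {r : ℝ} (hρ : ρ ≤ r) (hr : 0 < r) :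
    -lennardJones r ≤ f 0 := by
  have h1 := h.f_le_tail hρ hr
  have h2 := h.abs_f_le hr.le
  rw [abs_le] at h2
  linarith [h2.1]

/-- **THE BOCHNER CONE IS NECESSARILY CHARGED: `0 < f 0`** (test `r = max ρ 2`, where
`V_LJ < 0`).  In particular the `ρ = ∞` collapse `g = V_LJ, U = f = 0` is unavailable at every
real `ρ`. -/
theorem f_zero_pos (h : IsSplit ρ c g U f) : 0 < f 0 := by
  have hr : (0 : ℝ) < max ρ 2 := lt_of_lt_of_le (by norm_num) (le_max_right _ _)
  have hV : lennardJones (max ρ 2) < 0 :=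
    lennardJones_neg (lt_of_lt_of_le (by norm_num) (le_max_right _ _))
  have h1 := h.neg_lennardJones_le_f_zero (le_max_left _ _) hr
  linarith

/-- If the range is at most `1`, the Bochner cone pays at least the full well depth:
`f 0 ≥ 1/12 = −V_LJ(1)`. -/
theorem f_zero_ge_of_rho_le_one (h : IsSplit ρ c g U f) (hρ : ρ ≤ 1) : 1 / 12 ≤ f 0 := by
  have h1 := h.neg_lennardJones_le_f_zero hρ one_pos
  rw [lennardJones_one] at h1
  linarith

/-- The Bochner cone bound with unit weights: `−N·f 0/2 ≤ E_f(x)`. -/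
theorem f_energy_ge (h : IsSplit ρ c g U f) {N : ℕ} (x : Fin N → E3) :
    -((N : ℝ) * f 0 / 2) ≤ interactionEnergy f x := by
  have h1 := h.posType N x (fun _ => 1)
  simp only [one_mul] at h1
  rw [sum_sum_eq] at h1
  linarith

/-- The slack cone: `0 ≤ E_U(x)` on injective configurations. -/
theorem U_energy_nonneg (h : IsSplit ρ c g U f) {N : ℕ} {x : Fin N → E3}
    (hx : Function.Injective x) : 0 ≤ interactionEnergy U x :=
  interactionEnergy_nonneg_of_pos h.U_nonneg hx

/-- The three-cone decomposition of the Lennard-Jones energy of an injective configuration. -/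
theorem energy_eq (h : IsSplit ρ c g U f) {N : ℕ} {x : Fin N → E3} (hx : Function.Injective x) :
    interactionEnergy lennardJones x =
      interactionEnergy g x + interactionEnergy U x + interactionEnergy f x := by
  rw [interactionEnergy_congr_pos h.split hx, interactionEnergy_add, interactionEnergy_add]

/-- **The finite-N certificate bound** (mechanism of item 11962 CertificateBound, for ANY split,
no `P`): `−(c + f 0/2)·N ≤ E_LJ(x)` for every injective `x`. -/
theorem kepler (h : IsSplit ρ c g U f) {N : ℕ} {x : Fin N → E3} (hx : Function.Injective x) :
    -((c + f 0 / 2) * N) ≤ interactionEnergy lennardJones x := by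
  rw [h.energy_eq hx]
  have h1 := h.stable N x hx
  have h2 := h.U_energy_nonneg hx
  have h3 := h.f_energy_ge x
  nlinarith

/-- **THE VALUE FLOOR: `−e* ≤ c + f 0 / 2` for every split at every range.**  (Finite trial
states approach `e* = ⨅_Q e_LJ(Q)` from above, `exists_trialState` in the tree.)  So the three-cone
programme has value `≥ −e*` and (S6) can only be attained, never beaten. -/
theorem value_ge (h : IsSplit ρ c g U f) : -eStar ≤ c + f 0 / 2 := by
  by_contra hlt
  push Not at hlt
  obtain ⟨N, y, hN, hy, hE⟩ := exists_trialState (show 0 < -(c + f 0 / 2) - eStar by linarith)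
  have h1 := h.kepler hy
  have h2 : (N : ℝ) * (eStar + (-(c + f 0 / 2) - eStar)) = -((c + f 0 / 2) * N) := by ring
  linarith

/-- **Many-point Bochner budget**: for an injective configuration `y` all of whose pair distances
are `≥ ρ`, `−2·E_LJ(y) ≤ n·f 0` — the Bochner cone alone must pay twice the binding energy of
every `ρ`-separated cluster (unit weights in (S4), then `f ≤ V_LJ` on the tail). -/
theorem binding_le (h : IsSplit ρ c g U f) {n : ℕ} {y : Fin n → E3} (hy : Function.Injective y)
    (hsep : ∀ i j, i ≠ j → ρ ≤ dist (y i) (y j)) :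
    -(2 * interactionEnergy lennardJones y) ≤ n * f 0 := by
  have h1 := h.posType n y (fun _ => 1)
  simp only [one_mul] at h1
  rw [sum_sum_eq] at h1
  have h2 : interactionEnergy f y ≤ interactionEnergy lennardJones y := by
    unfold interactionEnergy
    refine Finset.sum_le_sum fun i _ => Finset.sum_le_sum fun j hj => ?_
    have hij : i ≠ j := (Finset.mem_Ioi.1 hj).ne
    exact h.f_le_tail (hsep i j hij) (dist_pos.2 fun heq => hij (hy heq))
  linarith

end IsSplit

/-! ## §2. Consequences for a witness: `e(P) = e*`, conjunct (i), and the factorisation -/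

/-- `E(N)/N → e*` for Lennard-Jones in `ℝ³` (re-derived from the tree: thermodynamic limit
`BlancLewin2015_8_holds`, trial states, periodisation; = `crysEnergyLimit` of the unbuilt module
`…Negative.Unconditional`). -/
theorem tendsto_div_eStar :
    Tendsto (fun N : ℕ => groundStateEnergy lennardJones 3 N / N) atTop (𝓝 eStar) := by
  obtain ⟨e, -, htend, -⟩ := BlancLewin2015_8_holds 3 (by norm_num) (by norm_num)
  have hup : e ≤ eStar := le_ciInf fun Q => le_energyPerParticle_of_tendsto htend Q
  have hdown : eStar ≤ e := by
    refine ge_of_tendsto htend (Filter.eventually_atTop.2 ⟨1, fun N hN => ?_⟩)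
    have hNr : (0 : ℝ) < N := by exact_mod_cast hN
    rw [le_div_iff₀ hNr, mul_comm]
    haveI := nonempty_injective_config (by norm_num : 0 < 3) N
    exact le_ciInf fun x =>
      card_mul_eStar_le_interactionEnergy bddBelow_energyPerParticle_lennardJones x.2
  obtain rfl : e = eStar := le_antisymm hup hdown
  exact htend

/-- `e* ≤ E(N)/N` for `N ≥ 1`. -/
theorem eStar_le_div {N : ℕ} (hN : 0 < N) : eStar ≤ groundStateEnergy lennardJones 3 N / N := by
  have hNr : (0 : ℝ) < N := by exact_mod_cast hN
  rw [le_div_iff₀ hNr, mul_comm]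
  haveI := nonempty_injective_config (by norm_num : 0 < 3) N
  exact le_ciInf fun x =>
    card_mul_eStar_le_interactionEnergy bddBelow_energyPerParticle_lennardJones x.2

/-- The energy of a two-point configuration. -/
theorem interactionEnergy_two (V : ℝ → ℝ) (a b : E3) : interactionEnergy V ![a, b] = V (dist a b) := by
  unfold interactionEnergy
  have h0 : Finset.Ioi (0 : Fin 2) = {1} := by decide
  have h1 : Finset.Ioi (1 : Fin 2) = ∅ := by decide
  simp [Fin.sum_univ_two, h0, h1]

/-- The dimer `(0, e₀)` is injective. -/
theorem dimer_injective : Function.Injective ![ax 0, ax 1] := by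
  intro i j hij
  fin_cases i <;> fin_cases j
  · rfl
  · exfalso
    have := congrArg (fun v : E3 => v 0) hij
    simp [ax] at this
  · exfalso
    have := congrArg (fun v : E3 => v 0) hij
    simp [ax] at this
  · rfl

/-- `e* ≤ −1/24 < 0` (the dimer at distance `1`). -/
theorem eStar_le_neg : eStar ≤ -(1 / 24) := by
  have h1 := card_mul_eStar_le_interactionEnergy bddBelow_energyPerParticle_lennardJones
    dimer_injective
  have h2 : interactionEnergy lennardJones ![ax 0, ax 1] = -(1 / 12) := by
    rw [interactionEnergy_two, dist_ax]
    norm_num [lennardJones_one]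
  rw [h2] at h1
  norm_num at h1
  linarith

/-- **For a witness, `e(P) = e*` and `c + f 0/2 = −e*`** — already when (S6) is weakened to `≤`. -/
theorem witness_eq {P : PeriodicConfiguration 3} {ρ c : ℝ} {g U f : ℝ → ℝ} (h : IsSplit ρ c g U f)
    (hv : c + f 0 / 2 ≤ -(P.energyPerParticle lennardJones)) :
    P.energyPerParticle lennardJones = eStar ∧ c + f 0 / 2 = -eStar := by
  have h1 := h.value_ge
  have h2 := eStar_le P
  constructor <;> linarith

/-- **A witness configuration is a periodic minimiser.** -/
theorem isLeast_of_witness {P : PeriodicConfiguration 3} {ρ c : ℝ} {g U f : ℝ → ℝ}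
    (h : IsSplit ρ c g U f) (hv : c + f 0 / 2 ≤ -(P.energyPerParticle lennardJones)) :
    IsLeast (Set.range fun Q : PeriodicConfiguration 3 => Q.energyPerParticle lennardJones)
      (P.energyPerParticle lennardJones) :=
  ⟨⟨P, rfl⟩, by
    rintro _ ⟨Q, rfl⟩
    rw [(witness_eq h hv).1]
    exact eStar_le Q⟩

/-- **Any witness has `e(P) ≤ −1/24 < 0` and value `c + f 0/2 ≥ 1/24`.** -/
theorem witness_bounds {P : PeriodicConfiguration 3} {ρ c : ℝ} {g U f : ℝ → ℝ}
    (h : IsSplit ρ c g U f) (hv : c + f 0 / 2 ≤ -(P.energyPerParticle lennardJones)) :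
    P.energyPerParticle lennardJones ≤ -(1 / 24) ∧ 1 / 24 ≤ c + f 0 / 2 := by
  obtain ⟨h1, h2⟩ := witness_eq h hv
  have h3 := eStar_le_neg
  constructor <;> linarith

/-- **`ExactCertificate` ⇒ conjunct (i) of the summit** (`HasPeriodicGroundStateEnergy V_LJ 3`),
directly: the witness `P` is a periodic minimiser and `E(N)/N → e* = e(P)`. -/
theorem hasPeriodicGroundStateEnergy_of_exactCertificate (h : ExactCertificate) :
    HasPeriodicGroundStateEnergy lennardJones 3 := by
  obtain ⟨P, ρ, c, g, U, f, hs, hv⟩ := exactCertificate_iff.1 h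
  refine ⟨P, isLeast_of_witness hs hv.le, ?_⟩
  rw [(witness_eq hs hv.le).1]
  exact tendsto_div_eStar

/-- The value statement WITHOUT `P`: some split has value `≤ −e*` (then `= −e*` by `value_ge`). -/
def SharpSplit : Prop :=
  ∃ (ρ c : ℝ) (g U f : ℝ → ℝ), IsSplit ρ c g U f ∧ c + f 0 / 2 ≤ -eStar

/-- The periodic infimum `e*` is attained. -/
def PeriodicMinimiser : Prop :=
  ∃ P : PeriodicConfiguration 3, P.energyPerParticle lennardJones = eStar

/-- **FACTORISATION: `ExactCertificate ↔ SharpSplit ∧ PeriodicMinimiser`.** -/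
theorem exactCertificate_iff_sharp_and_attained :
    ExactCertificate ↔ SharpSplit ∧ PeriodicMinimiser := by
  rw [exactCertificate_iff]
  constructor
  · rintro ⟨P, ρ, c, g, U, f, hs, hv⟩
    obtain ⟨h1, h2⟩ := witness_eq hs hv.le
    exact ⟨⟨ρ, c, g, U, f, hs, h2.le⟩, ⟨P, h1⟩⟩
  · rintro ⟨⟨ρ, c, g, U, f, hs, hv⟩, ⟨P, hP⟩⟩
    refine ⟨P, ρ, c, g, U, f, hs, ?_⟩
    rw [hP]
    have := hs.value_ge
    linarith

/-- **`=` versus `≤` in (S6)**: the weakened crux with `c + f 0/2 ≤ −e(P)` is the same statement. -/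
theorem exactCertificate_iff_le :
    ExactCertificate ↔ ∃ (P : PeriodicConfiguration 3) (ρ c : ℝ) (g U f : ℝ → ℝ),
      IsSplit ρ c g U f ∧ c + f 0 / 2 ≤ -(P.energyPerParticle lennardJones) := by
  rw [exactCertificate_iff]
  refine ⟨fun ⟨P, ρ, c, g, U, f, hs, hv⟩ => ⟨P, ρ, c, g, U, f, hs, hv.le⟩,
    fun ⟨P, ρ, c, g, U, f, hs, hv⟩ => ⟨P, ρ, c, g, U, f, hs, ?_⟩⟩
  obtain ⟨h1, h2⟩ := witness_eq hs hv
  rw [h1, h2]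

/-- **`KeplerBound ↔ PeriodicMinimiser`** (item 11961 is exactly "the periodic infimum is
attained"): `→` by trial states, `←` by periodisation (`N·e* ≤ E_LJ(x)`, tree). -/
theorem keplerBound_iff_periodicMinimiser : KeplerBound ↔ PeriodicMinimiser := by
  constructor
  · rintro ⟨P, hP⟩
    refine ⟨P, le_antisymm ?_ (eStar_le P)⟩
    by_contra hlt
    push Not at hlt
    obtain ⟨N, y, hN, hy, hE⟩ := exists_trialState (show 0 < P.energyPerParticle lennardJones - eStar
      by linarith)
    have h1 := hP N y hy
    have h2 : (N : ℝ) * (eStar + (P.energyPerParticle lennardJones - eStar)) =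
        N * P.energyPerParticle lennardJones := by ring
    linarith
  · rintro ⟨P, hP⟩
    refine ⟨P, fun N x hx => ?_⟩
    rw [hP]
    exact card_mul_eStar_le_interactionEnergy bddBelow_energyPerParticle_lennardJones hx

/-- **`PeriodicMinimiser ↔ HasPeriodicGroundStateEnergy V_LJ 3`** (conjunct (i) of the summit). -/
theorem periodicMinimiser_iff_conjunct_i :
    PeriodicMinimiser ↔ HasPeriodicGroundStateEnergy lennardJones 3 := by
  constructor
  · rintro ⟨P, hP⟩
    refine ⟨P, ⟨⟨P, rfl⟩, ?_⟩, ?_⟩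
    · rintro _ ⟨Q, rfl⟩
      rw [hP]
      exact eStar_le Q
    · rw [hP]
      exact tendsto_div_eStar
  · rintro ⟨P, hleast, -⟩
    refine ⟨P, le_antisymm ?_ (eStar_le P)⟩
    exact le_ciInf fun Q => hleast.2 ⟨Q, rfl⟩

/-- Hence **`KeplerBound ↔ conjunct (i)`**. -/
theorem keplerBound_iff_conjunct_i : KeplerBound ↔ HasPeriodicGroundStateEnergy lennardJones 3 :=
  keplerBound_iff_periodicMinimiser.trans periodicMinimiser_iff_conjunct_i

/-- So the crux reads: **`ExactCertificate ↔ SharpSplit ∧ KeplerBound`**. -/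
theorem exactCertificate_iff_sharp_and_kepler : ExactCertificate ↔ SharpSplit ∧ KeplerBound := by
  rw [exactCertificate_iff_sharp_and_attained, keplerBound_iff_periodicMinimiser]

/-- Item 11963 `TrialStateUpper` holds (three lines from `tendsto_div_eStar`; recorded for the
provers — the refuter does not land route items). -/
theorem trialStateUpper_holds : TrialStateUpper := by
  intro Q ε hε
  have h := tendsto_div_eStar
  have hev : ∀ᶠ N : ℕ in atTop, groundStateEnergy lennardJones 3 N / N < eStar + ε :=
    h.eventually (gt_mem_nhds (by linarith))
  exact hev.mono fun N hN => by linarith [eStar_le Q]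

/-- Item 11962 `CertificateBound` holds (the ten-line derivation, = `IsSplit.kepler`). -/
theorem certificateBound_holds : CertificateBound := by
  intro h
  obtain ⟨P, ρ, c, g, U, f, hs, hv⟩ := exactCertificate_iff.1 h
  refine ⟨P, fun N x hx => ?_⟩
  have := hs.kepler hx
  rw [hv] at this
  linarith

/-- Item 11964 `EnergeticHalf` holds (indeed `KeplerBound` alone gives conjunct (i)). -/
theorem energeticHalf_holds : EnergeticHalf := fun hK _ => keplerBound_iff_conjunct_i.1 hK

/-! ### Normal form: the crux is about ONE radial function -/

/-- Energies are monotone in the potential on injective configurations. -/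
theorem interactionEnergy_mono_pos {V W : ℝ → ℝ} (h : ∀ r, 0 < r → V r ≤ W r) {N : ℕ}
    {x : Fin N → E3} (hx : Function.Injective x) :
    interactionEnergy V x ≤ interactionEnergy W x := by
  unfold interactionEnergy
  refine Finset.sum_le_sum fun i _ => Finset.sum_le_sum fun j hj => h _ ?_
  exact dist_pos.2 fun heq => (Finset.mem_Ioi.1 hj).ne' (hx heq.symm)

/-- The truncated remainder `(V_LJ − f)·1_{(0,ρ)}`: the canonical finite-range part of a split. -/
def gOf (ρ : ℝ) (f : ℝ → ℝ) (r : ℝ) : ℝ := if r < ρ then lennardJones r - f r else 0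

/-- **NORMAL FORM — THE CRUX IS A STATEMENT ABOUT ONE RADIAL FUNCTION `f`**: `U` may be taken `0` below
`ρ` and `g, U, c` are then determined by `f`:
`ExactCertificate ↔ ∃ P ρ f, f radially of positive type ∧ f ≤ V_LJ on [ρ,∞) ∩ (0,∞) ∧
 (V_LJ − f)·1_{(0,ρ)} is (−e(P) − f 0/2)-stable`, i.e. `(e(P) + f 0/2)·N ≤ Σ_{i<j, d<ρ} (V_LJ − f)(d_ij)`
for every injective `x`.  (`→`: move `U·1_{(0,ρ)} ≥ 0` into `g`; `←`: `g := (V−f)1_{(0,ρ)}`,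
`U := (V−f)1_{[ρ,∞)}`, `c := −e(P) − f 0/2`.) -/
theorem exactCertificate_iff_single :
    ExactCertificate ↔ ∃ (P : PeriodicConfiguration 3) (ρ : ℝ) (f : ℝ → ℝ),
      (∀ (n : ℕ) (y : Fin n → E3) (w : Fin n → ℝ), 0 ≤ ∑ i, ∑ j, w i * w j * f (dist (y i) (y j))) ∧
      (∀ r, ρ ≤ r → 0 < r → f r ≤ lennardJones r) ∧
      (∀ (N : ℕ) (x : Fin N → E3), Function.Injective x →
        (P.energyPerParticle lennardJones + f 0 / 2) * N ≤ interactionEnergy (gOf ρ f) x) := by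
  rw [exactCertificate_iff]
  constructor
  · rintro ⟨P, ρ, c, g, U, f, hs, hv⟩
    refine ⟨P, ρ, f, hs.posType, fun r hρ hr => hs.f_le_tail hρ hr, fun N x hx => ?_⟩
    have hmono : interactionEnergy g x ≤ interactionEnergy (gOf ρ f) x := by
      refine interactionEnergy_mono_pos (fun r hr => ?_) hx
      unfold gOf
      split_ifs with hlt
      · have h1 := hs.split r hr
        have h2 := hs.U_nonneg r hr
        linarith
      · exact (hs.g_zero r (not_lt.1 hlt)).le
    have hst := hs.stable N x hx
    have he : P.energyPerParticle lennardJones = -(c + f 0 / 2) := by linarith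
    have : (P.energyPerParticle lennardJones + f 0 / 2) * N = -(c * N) := by rw [he]; ring
    rw [this]
    exact hst.trans hmono
  · rintro ⟨P, ρ, f, hpd, htail, hstab⟩
    refine ⟨P, ρ, -(P.energyPerParticle lennardJones) - f 0 / 2, gOf ρ f,
      fun r => if r < ρ then 0 else lennardJones r - f r, f, ⟨?_, ?_, ?_, hpd, ?_⟩, by ring⟩
    · intro r _
      show lennardJones r = gOf ρ f r + (if r < ρ then 0 else lennardJones r - f r) + f r
      unfold gOf
      split_ifs <;> ring
    · intro r hr
      show 0 ≤ (if r < ρ then 0 else lennardJones r - f r)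
      split_ifs with hlt
      · exact le_rfl
      · have := htail r (not_lt.1 hlt) hr
        linarith
    · intro r hρ
      unfold gOf
      rw [if_neg (not_lt.2 hρ)]
    · intro N x hx
      have := hstab N x hx
      have e1 : -((-P.energyPerParticle lennardJones - f 0 / 2) * (N : ℝ)) =
          (P.energyPerParticle lennardJones + f 0 / 2) * N := by ring
      rw [e1]
      exact this

/-- In the normal form the value floor reads: **`−e* ≤ −e(P)`… no — it reads `e(P) + f 0/2 ≥ …`**;
precisely, for ANY `ρ, f` with `f` of positive type and `f ≤ V_LJ` on the tail, and any real `κ` with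
`κ·N ≤ E_{gOf ρ f}(x)` for all injective `x`, one has `κ ≤ e* + f 0/2` (so `κ = e(P) + f 0/2` forces
`e(P) = e*`). -/
theorem kappa_le_of_single {ρ κ : ℝ} {f : ℝ → ℝ}
    (hpd : ∀ (n : ℕ) (y : Fin n → E3) (w : Fin n → ℝ), 0 ≤ ∑ i, ∑ j, w i * w j * f (dist (y i) (y j)))
    (htail : ∀ r, ρ ≤ r → 0 < r → f r ≤ lennardJones r)
    (hstab : ∀ (N : ℕ) (x : Fin N → E3), Function.Injective x → κ * N ≤ interactionEnergy (gOf ρ f) x) :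
    κ ≤ eStar + f 0 / 2 := by
  have hs : IsSplit ρ (-κ) (gOf ρ f) (fun r => if r < ρ then 0 else lennardJones r - f r) f := by
    refine ⟨?_, ?_, ?_, hpd, ?_⟩
    · intro r _
      show lennardJones r = gOf ρ f r + (if r < ρ then 0 else lennardJones r - f r) + f r
      unfold gOf
      split_ifs <;> ring
    · intro r hr
      show 0 ≤ (if r < ρ then 0 else lennardJones r - f r)
      split_ifs with hlt
      · exact le_rfl
      · have := htail r (not_lt.1 hlt) hr
        linarith
    · intro r hρ
      unfold gOf
      rw [if_neg (not_lt.2 hρ)]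
    · intro N x hx
      have := hstab N x hx
      have e1 : -((-κ) * (N : ℝ)) = κ * N := by ring
      rw [e1]
      exact this
  have := hs.value_ge
  linarith

/-! ## §3. Load-bearing analysis: the crux with one hypothesis dropped -/

/-- (S4) dropped: no positive type. -/
def WithoutPosType : Prop :=
  ∃ (P : PeriodicConfiguration 3) (ρ c : ℝ) (g U f : ℝ → ℝ),
    (∀ r : ℝ, 0 < r → lennardJones r = g r + U r + f r) ∧ (∀ r : ℝ, 0 < r → 0 ≤ U r) ∧
    (∀ r : ℝ, ρ ≤ r → g r = 0) ∧
    (∀ (N : ℕ) (x : Fin N → E3), Function.Injective x → -(c * (N : ℝ)) ≤ interactionEnergy g x) ∧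
    c + f 0 / 2 = -(P.energyPerParticle lennardJones)

/-- **Without (S4) the crux is trivially TRUE, for every `P`**: `g = U = 0`, `f = V_LJ` off the
origin and `f 0 := −2e(P)` (the value of `f` at `0` is free once positive type is gone). -/
theorem withoutPosType_trivial (P : PeriodicConfiguration 3) :
    ∃ (ρ c : ℝ) (g U f : ℝ → ℝ),
    (∀ r : ℝ, 0 < r → lennardJones r = g r + U r + f r) ∧ (∀ r : ℝ, 0 < r → 0 ≤ U r) ∧
    (∀ r : ℝ, ρ ≤ r → g r = 0) ∧
    (∀ (N : ℕ) (x : Fin N → E3), Function.Injective x → -(c * (N : ℝ)) ≤ interactionEnergy g x) ∧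
    c + f 0 / 2 = -(P.energyPerParticle lennardJones) := by
  refine ⟨0, 0, fun _ => 0, fun _ => 0,
    fun r => if r = 0 then -2 * P.energyPerParticle lennardJones else lennardJones r,
    ?_, ?_, ?_, ?_, ?_⟩
  · intro r hr; simp [hr.ne']
  · intro r _; simp
  · intro r _; simp
  · intro N x _; simp [interactionEnergy]
  · have h0 : (fun r : ℝ => if r = 0 then -2 * P.energyPerParticle lennardJones else lennardJones r) 0
        = -2 * P.energyPerParticle lennardJones := if_pos rfl
    rw [h0]; ring

theorem withoutPosType_holds : WithoutPosType :=
  let P : PeriodicConfiguration 3 := Classical.arbitrary _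
  ⟨P, withoutPosType_trivial P⟩

/-- There is a periodic configuration with NEGATIVE Lennard-Jones energy per particle
(`e* ≤ −1/24` is a genuine infimum). -/
theorem exists_energyPerParticle_neg :
    ∃ Q : PeriodicConfiguration 3, Q.energyPerParticle lennardJones < 0 := by
  have hlt : eStar < 0 := by linarith [eStar_le_neg]
  obtain ⟨Q, hQ⟩ := exists_lt_of_ciInf_lt hlt
  exact ⟨Q, hQ⟩

/-- A non-negative constant is radially of positive type: `Σᵢⱼ wᵢ wⱼ K = K (Σ w)² ≥ 0`. -/
theorem posType_const {K : ℝ} (hK : 0 ≤ K) (n : ℕ) (y : Fin n → E3) (w : Fin n → ℝ) :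
    0 ≤ ∑ i, ∑ j, w i * w j * (fun _ : ℝ => K) (dist (y i) (y j)) := by
  have : ∑ i, ∑ j, w i * w j * (fun _ : ℝ => K) (dist (y i) (y j)) = K * (∑ i, w i) ^ 2 := by
    simp only [sq, Finset.sum_mul, Finset.mul_sum]
    refine Finset.sum_congr rfl fun i _ => Finset.sum_congr rfl fun j _ => by ring
  rw [this]
  positivity

/-- (S2) dropped: no sign on the slack `U`. -/
def WithoutUNonneg : Prop :=
  ∃ (P : PeriodicConfiguration 3) (ρ c : ℝ) (g U f : ℝ → ℝ),
    (∀ r : ℝ, 0 < r → lennardJones r = g r + U r + f r) ∧ (∀ r : ℝ, ρ ≤ r → g r = 0) ∧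
    (∀ (n : ℕ) (y : Fin n → E3) (w : Fin n → ℝ), 0 ≤ ∑ i, ∑ j, w i * w j * f (dist (y i) (y j))) ∧
    (∀ (N : ℕ) (x : Fin N → E3), Function.Injective x → -(c * (N : ℝ)) ≤ interactionEnergy g x) ∧
    c + f 0 / 2 = -(P.energyPerParticle lennardJones)

/-- **Without (S2) the crux is trivially TRUE**: at a periodic `Q` with `e(Q) < 0` take
`g = 0`, `c = 0`, the constant `f ≡ −2e(Q) ≥ 0` (positive type) and `U := V_LJ − f` (of either
sign).  So `U ≥ 0` is load-bearing: it is what forces `f ≤ V_LJ` on the tail. -/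
theorem withoutUNonneg_holds : WithoutUNonneg := by
  obtain ⟨Q, hQ⟩ := exists_energyPerParticle_neg
  refine ⟨Q, 0, 0, fun _ => 0, fun r => lennardJones r - (-2 * Q.energyPerParticle lennardJones),
    fun _ => -2 * Q.energyPerParticle lennardJones, ?_, ?_, ?_, ?_, ?_⟩
  · intro r _; ring
  · intro r _; rfl
  · exact posType_const (by linarith)
  · intro N x _; simp [interactionEnergy]
  · ring

/-- (S1) dropped: `g, U, f` need not split `V_LJ`. -/
def WithoutSplit : Prop :=
  ∃ (P : PeriodicConfiguration 3) (ρ c : ℝ) (g U f : ℝ → ℝ),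
    (∀ r : ℝ, 0 < r → 0 ≤ U r) ∧ (∀ r : ℝ, ρ ≤ r → g r = 0) ∧
    (∀ (n : ℕ) (y : Fin n → E3) (w : Fin n → ℝ), 0 ≤ ∑ i, ∑ j, w i * w j * f (dist (y i) (y j))) ∧
    (∀ (N : ℕ) (x : Fin N → E3), Function.Injective x → -(c * (N : ℝ)) ≤ interactionEnergy g x) ∧
    c + f 0 / 2 = -(P.energyPerParticle lennardJones)

/-- **Without (S1) the crux is trivially TRUE** (`g = U = 0`, constant `f ≡ −2e(Q) ≥ 0`). -/
theorem withoutSplit_holds : WithoutSplit := by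
  obtain ⟨Q, hQ⟩ := exists_energyPerParticle_neg
  refine ⟨Q, 0, 0, fun _ => 0, fun _ => 0, fun _ => -2 * Q.energyPerParticle lennardJones,
    ?_, ?_, ?_, ?_, ?_⟩
  · intro r _; rfl
  · intro r _; rfl
  · exact posType_const (by linarith)
  · intro N x _; simp [interactionEnergy]
  · ring

/-- (S3) dropped: `g` need not have finite range. -/
def WithoutFiniteRange : Prop :=
  ∃ (P : PeriodicConfiguration 3) (c : ℝ) (g U f : ℝ → ℝ),
    (∀ r : ℝ, 0 < r → lennardJones r = g r + U r + f r) ∧ (∀ r : ℝ, 0 < r → 0 ≤ U r) ∧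
    (∀ (n : ℕ) (y : Fin n → E3) (w : Fin n → ℝ), 0 ≤ ∑ i, ∑ j, w i * w j * f (dist (y i) (y j))) ∧
    (∀ (N : ℕ) (x : Fin N → E3), Function.Injective x → -(c * (N : ℝ)) ≤ interactionEnergy g x) ∧
    c + f 0 / 2 = -(P.energyPerParticle lennardJones)

/-- **Without (S3) the crux is EXACTLY `KeplerBound`** (⇔ the periodic infimum is attained ⇔
conjunct (i)): `←` with `g := V_LJ`, `U = f = 0`, `c := −e(P)`; `→` by the certificate bound,
which never uses the range.  Finite range is the hypothesis that separates the crux from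
conjunct (i). -/
theorem withoutFiniteRange_iff_keplerBound : WithoutFiniteRange ↔ KeplerBound := by
  constructor
  · rintro ⟨P, c, g, U, f, h1, h2, h4, h5, h6⟩
    -- `IsSplit` with the vacuous range hypothesis replaced: redo the certificate bound by hand
    refine ⟨P, fun N x hx => ?_⟩
    have hE : interactionEnergy lennardJones x =
        interactionEnergy g x + interactionEnergy U x + interactionEnergy f x := by
      rw [interactionEnergy_congr_pos h1 hx, interactionEnergy_add, interactionEnergy_add]
    have hU : 0 ≤ interactionEnergy U x := interactionEnergy_nonneg_of_pos h2 hx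
    have hf : -((N : ℝ) * f 0 / 2) ≤ interactionEnergy f x := by
      have := h4 N x (fun _ => 1)
      simp only [one_mul] at this
      rw [sum_sum_eq] at this
      linarith
    have hg := h5 N x hx
    rw [hE]
    have : (N : ℝ) * P.energyPerParticle lennardJones = -((c + f 0 / 2) * N) := by rw [h6]; ring
    rw [this]
    nlinarith
  · rintro ⟨P, hP⟩
    refine ⟨P, -(P.energyPerParticle lennardJones), lennardJones, fun _ => 0, fun _ => 0,
      ?_, ?_, ?_, ?_, ?_⟩
    · intro r _; ring
    · intro r _; rfl
    · intro n y w; simp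
    · intro N x hx
      have := hP N x hx
      linarith
    · ring

/-- Bare feasibility of the cone split: (S1)–(S4) at some range (no stability, no value). -/
def Feasible : Prop :=
  ∃ (ρ : ℝ) (g U f : ℝ → ℝ),
    (∀ r : ℝ, 0 < r → lennardJones r = g r + U r + f r) ∧ (∀ r : ℝ, 0 < r → 0 ≤ U r) ∧
    (∀ r : ℝ, ρ ≤ r → g r = 0) ∧
    (∀ (n : ℕ) (y : Fin n → E3) (w : Fin n → ℝ), 0 ≤ ∑ i, ∑ j, w i * w j * f (dist (y i) (y j)))

/-- Feasibility with a stable finite-range part: (S1)–(S5) at some range, no value equation. -/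
def FeasibleStable : Prop := ∃ (ρ c : ℝ) (g U f : ℝ → ℝ), IsSplit ρ c g U f

/-- What feasibility really asks of real analysis: a radial function of positive type on `ℝ³`
lying below `V_LJ < 0` on a neighbourhood of infinity (so with a fat negative tail `≤ −r⁻⁶/6`). -/
theorem Feasible.tail (h : Feasible) :
    ∃ (ρ : ℝ) (f : ℝ → ℝ),
      (∀ (n : ℕ) (y : Fin n → E3) (w : Fin n → ℝ), 0 ≤ ∑ i, ∑ j, w i * w j * f (dist (y i) (y j))) ∧
      ∀ r, ρ ≤ r → 0 < r → f r ≤ lennardJones r := by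
  obtain ⟨ρ, g, U, f, h1, h2, h3, h4⟩ := h
  refine ⟨ρ, f, h4, fun r hρ hr => ?_⟩
  have := h1 r hr
  rw [h3 r hρ] at this
  have := h2 r hr
  linarith

/-- (S5) dropped: no stability of `g` (then `c` is a free real). -/
def WithoutStability : Prop :=
  ∃ (P : PeriodicConfiguration 3) (ρ c : ℝ) (g U f : ℝ → ℝ),
    (∀ r : ℝ, 0 < r → lennardJones r = g r + U r + f r) ∧ (∀ r : ℝ, 0 < r → 0 ≤ U r) ∧
    (∀ r : ℝ, ρ ≤ r → g r = 0) ∧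
    (∀ (n : ℕ) (y : Fin n → E3) (w : Fin n → ℝ), 0 ≤ ∑ i, ∑ j, w i * w j * f (dist (y i) (y j))) ∧
    c + f 0 / 2 = -(P.energyPerParticle lennardJones)

/-- **Without (S5) the crux is EXACTLY bare feasibility** (`c := −e(P) − f 0/2` is free). -/
theorem withoutStability_iff_feasible : WithoutStability ↔ Feasible := by
  constructor
  · rintro ⟨P, ρ, c, g, U, f, h1, h2, h3, h4, -⟩
    exact ⟨ρ, g, U, f, h1, h2, h3, h4⟩
  · rintro ⟨ρ, g, U, f, h1, h2, h3, h4⟩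
    let P : PeriodicConfiguration 3 := Classical.arbitrary _
    exact ⟨P, ρ, -(P.energyPerParticle lennardJones) - f 0 / 2, g, U, f, h1, h2, h3, h4, by ring⟩

/-- (S6) dropped: no value equation. -/
def WithoutEquation : Prop :=
  ∃ (_P : PeriodicConfiguration 3) (ρ c : ℝ) (g U f : ℝ → ℝ), IsSplit ρ c g U f

/-- **Without (S6) the crux is EXACTLY stable feasibility.** -/
theorem withoutEquation_iff_feasibleStable : WithoutEquation ↔ FeasibleStable := by
  constructor
  · rintro ⟨-, ρ, c, g, U, f, h⟩
    exact ⟨ρ, c, g, U, f, h⟩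
  · rintro ⟨ρ, c, g, U, f, h⟩
    exact ⟨Classical.arbitrary _, ρ, c, g, U, f, h⟩

/-- The crux implies stable feasibility implies feasibility (the analytic content that every
witness carries: a positive-type `f` below `V_LJ` on the tail). -/
theorem feasibleStable_of_exactCertificate (h : ExactCertificate) : FeasibleStable := by
  obtain ⟨P, ρ, c, g, U, f, hs, -⟩ := exactCertificate_iff.1 h
  exact ⟨ρ, c, g, U, f, hs⟩

theorem FeasibleStable.feasible (h : FeasibleStable) : Feasible := by
  obtain ⟨ρ, c, g, U, f, h1, h2, h3, h4, -⟩ := h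
  exact ⟨ρ, g, U, f, h1, h2, h3, h4⟩

/-! ## §4. Tightness along blocks of the witness configuration (complementary slackness) -/

open Summit.AtomisticToContinuum.Crystallization.Theorems.ChargedEnergyGapNegative.Blocks
  (BIdx bpt bpt_injective blockConfig blockConfig_apply blockConfig_injective card_BIdx latVec
    latVec_add latVec_mem exists_latVec_eq coords IsDeep card_not_deep_le exists_block_energy_le
    siteSum siteSum_bpt sum_siteSum_eq blockOthers tail sum_blockOthers depth le_dist_of_deep)

/-- **The three slacks of a witness are `o(N)` along the `K`-blocks of `P`**: for every `ε > 0`,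
eventually `(E_g + c·N) + E_U + (E_f + N·f 0/2) ≤ ε·N` on the block configuration of `N = #F·K³`
points, each bracket being `≥ 0`.  (Blocks are trial states: `E_LJ(block) ≤ N·(e(P) + ε)`, tree.) -/
theorem slacks_le {P : PeriodicConfiguration 3} {ρ c : ℝ} {g U f : ℝ → ℝ} (h : IsSplit ρ c g U f)
    (hv : c + f 0 / 2 ≤ -(P.energyPerParticle lennardJones)) {ε : ℝ} (hε : 0 < ε) :
    ∃ K₀ : ℕ, 0 < K₀ ∧ ∀ K : ℕ, K₀ ≤ K →
      (interactionEnergy g (blockConfig P K) + c * Fintype.card (BIdx P K)) +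
        interactionEnergy U (blockConfig P K) +
        (interactionEnergy f (blockConfig P K) + Fintype.card (BIdx P K) * f 0 / 2) ≤
      ε * Fintype.card (BIdx P K) := by
  obtain ⟨K₀, hK₀, hK⟩ := exists_block_energy_le P hε
  refine ⟨K₀, hK₀, fun K hKK => ?_⟩
  have h1 := hK K hKK
  rw [h.energy_eq (blockConfig_injective P K)] at h1
  obtain ⟨-, h2⟩ := witness_eq h hv
  have h3 : P.energyPerParticle lennardJones = -(c + f 0 / 2) := by
    have := (witness_eq h hv).1; linarith
  rw [h3] at h1
  nlinarith [h1]

/-- The three brackets are individually non-negative, so each is eventually `≤ ε·N`; here the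
`g`-slack: **`P` is asymptotically a per-particle ground state of `g` with energy `−c`**. -/
theorem g_slack_le {P : PeriodicConfiguration 3} {ρ c : ℝ} {g U f : ℝ → ℝ} (h : IsSplit ρ c g U f)
    (hv : c + f 0 / 2 ≤ -(P.energyPerParticle lennardJones)) {ε : ℝ} (hε : 0 < ε) :
    ∃ K₀ : ℕ, 0 < K₀ ∧ ∀ K : ℕ, K₀ ≤ K →
      interactionEnergy g (blockConfig P K) + c * Fintype.card (BIdx P K) ≤
        ε * Fintype.card (BIdx P K) := by
  obtain ⟨K₀, hK₀, hK⟩ := slacks_le h hv hε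
  refine ⟨K₀, hK₀, fun K hKK => ?_⟩
  have h1 := hK K hKK
  have h2 := h.U_energy_nonneg (blockConfig_injective P K)
  have h3 := h.f_energy_ge (blockConfig P K)
  linarith

/-- The `U`-slack: **the slack cone is asymptotically empty on `P`** (`Σ U` over a block is
`o(N)`; with pair counting this gives `U = 0` on `D_P ∩ [ρ,∞)` — `U_eq_zero_of_mem_points` below). -/
theorem U_slack_le {P : PeriodicConfiguration 3} {ρ c : ℝ} {g U f : ℝ → ℝ} (h : IsSplit ρ c g U f)
    (hv : c + f 0 / 2 ≤ -(P.energyPerParticle lennardJones)) {ε : ℝ} (hε : 0 < ε) :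
    ∃ K₀ : ℕ, 0 < K₀ ∧ ∀ K : ℕ, K₀ ≤ K →
      interactionEnergy U (blockConfig P K) ≤ ε * Fintype.card (BIdx P K) := by
  obtain ⟨K₀, hK₀, hK⟩ := slacks_le h hv hε
  refine ⟨K₀, hK₀, fun K hKK => ?_⟩
  have h1 := hK K hKK
  have h2 := h.stable _ _ (blockConfig_injective P K)
  have h3 := h.f_energy_ge (blockConfig P K)
  linarith

/-- The `f`-slack: **the Bochner form of `P` with unit weights is asymptotically extremal**
(`N·f 0 + 2E_f = Σᵢⱼ f = o(N)`: the `P`-sum of `f` including `f 0` vanishes). -/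
theorem f_slack_le {P : PeriodicConfiguration 3} {ρ c : ℝ} {g U f : ℝ → ℝ} (h : IsSplit ρ c g U f)
    (hv : c + f 0 / 2 ≤ -(P.energyPerParticle lennardJones)) {ε : ℝ} (hε : 0 < ε) :
    ∃ K₀ : ℕ, 0 < K₀ ∧ ∀ K : ℕ, K₀ ≤ K →
      interactionEnergy f (blockConfig P K) + Fintype.card (BIdx P K) * f 0 / 2 ≤
        ε * Fintype.card (BIdx P K) := by
  obtain ⟨K₀, hK₀, hK⟩ := slacks_le h hv hε
  refine ⟨K₀, hK₀, fun K hKK => ?_⟩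
  have h1 := hK K hKK
  have h2 := h.stable _ _ (blockConfig_injective P K)
  have h3 := h.U_energy_nonneg (blockConfig_injective P K)
  linarith

/-- **Pair counting in blocks**: a distance `d = dist p q` realised by two points of `P` is
realised at least `K³ − 6MK²` times (once per `M`-deep lattice coordinate) among ordered pairs of
the `K`-block, so for a potential `W ≥ 0` on `(0,∞)`:
`(K³ − 6MK²)·W(d) ≤ 2·E_W(block_K)`. -/
theorem sub_mul_le_two_mul_energy (P : PeriodicConfiguration 3) {W : ℝ → ℝ}
    (hW : ∀ r, 0 < r → 0 ≤ W r) {p q : E3} (hp : p ∈ P.points) (hq : q ∈ P.points)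
    (hpq : p ≠ q) :
    ∃ M : ℕ, ∀ K : ℕ, ((K : ℝ) ^ 3 - 6 * M * (K : ℝ) ^ 2) * W (dist p q) ≤
      2 * interactionEnergy W (blockConfig P K) := by
  classical
  obtain ⟨x, hx, g₁, hg₁, rfl⟩ := hp
  obtain ⟨x', hx', g₂, hg₂, rfl⟩ := hq
  obtain ⟨Δ, hΔ⟩ := exists_latVec_eq P (P.lattice.sub_mem hg₂ hg₁)
  set M : ℕ := ∑ i, (Δ i).natAbs with hM
  have hΔM : ∀ i, ((Δ i).natAbs : ℤ) ≤ M := fun i => by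
    have : (Δ i).natAbs ≤ M :=
      Finset.single_le_sum (f := fun j => (Δ j).natAbs) (fun j _ => Nat.zero_le _)
        (Finset.mem_univ i)
    exact_mod_cast this
  refine ⟨M, fun K => ?_⟩
  set d : ℝ := dist (x + g₁) (x' + g₂) with hd
  have hdpos : 0 < d := dist_pos.2 hpq
  have hWd : 0 ≤ W d := hW d hdpos
  -- deep coordinates and their shifts by `Δ`
  set D : Finset (Fin 3 → Fin K) := Finset.univ.filter fun k => IsDeep K M k with hD
  let sh : (Fin 3 → Fin K) → (Fin 3 → Fin K) := fun k i =>
    ⟨(((k i : ℕ) : ℤ) + Δ i).toNat % K, Nat.mod_lt _ (k i).pos⟩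
  have hsh : ∀ k, IsDeep K M k → ∀ i, ((sh k i : ℕ) : ℤ) = ((k i : ℕ) : ℤ) + Δ i := by
    intro k hk i
    have h1 := (hk i).1
    have h2 := (hk i).2
    have h3 := hΔM i
    have h4 : ((Δ i).natAbs : ℤ) = |Δ i| := Int.natCast_natAbs (Δ i)
    have h5 : -((Δ i).natAbs : ℤ) ≤ Δ i ∧ Δ i ≤ ((Δ i).natAbs : ℤ) := by
      rw [h4]; exact abs_le.1 le_rfl
    have hnn : 0 ≤ ((k i : ℕ) : ℤ) + Δ i := by omega
    have hlt : ((((k i : ℕ) : ℤ) + Δ i).toNat) < K := by omega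
    show (((((k i : ℕ) : ℤ) + Δ i).toNat % K : ℕ) : ℤ) = _
    rw [Nat.mod_eq_of_lt hlt]
    omega
  have hcoords : ∀ k, IsDeep K M k → coords K (sh k) = coords K k + Δ := by
    intro k hk
    funext i
    simp only [coords, Pi.add_apply]
    exact hsh k hk i
  -- the partner of the block point `(x, k)` is `(x', sh k)`, at distance exactly `d`
  have hpartner : ∀ k, IsDeep K M k →
      dist (bpt P K (⟨x, hx⟩, k)) (bpt P K (⟨x', hx'⟩, sh k)) = d := by
    intro k hk
    have h1 : bpt P K (⟨x', hx'⟩, sh k) = bpt P K (⟨x, hx⟩, k) + ((x' + g₂) - (x + g₁)) := by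
      simp only [bpt, hcoords k hk, latVec_add, hΔ]
      abel
    rw [h1, hd, dist_eq_norm, dist_eq_norm, sub_add_cancel_left, norm_neg]
    exact norm_sub_rev _ _
  -- rows of the double sum
  set e := Fintype.equivFin (BIdx P K) with he
  set T : Finset (Fin (Fintype.card (BIdx P K))) := D.image fun k => e (⟨x, hx⟩, k) with hT
  have hTcard : T.card = D.card := by
    rw [hT, Finset.card_image_of_injective]
    intro k k' h
    have := e.injective h
    simpa using this
  have hrow_nonneg : ∀ a, 0 ≤ siteEnergy W (blockConfig P K) a := by
    intro a
    refine Finset.sum_nonneg fun b hb => hW _ (dist_pos.2 fun heq => ?_)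
    exact (Finset.ne_of_mem_erase hb) ((blockConfig_injective P K) heq).symm
  have hrow : ∀ a ∈ T, W d ≤ siteEnergy W (blockConfig P K) a := by
    intro a ha
    obtain ⟨k, hk, rfl⟩ := Finset.mem_image.1 ha
    have hkD : IsDeep K M k := (Finset.mem_filter.1 hk).2
    set b := e (⟨x', hx'⟩, sh k) with hb
    have hdist : dist (blockConfig P K (e (⟨x, hx⟩, k))) (blockConfig P K b) = d := by
      simp only [blockConfig_apply, hb, he, Equiv.symm_apply_apply]
      exact hpartner k hkD
    have hba : b ∈ Finset.univ.erase (e (⟨x, hx⟩, k)) := by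
      refine Finset.mem_erase.2 ⟨fun hbe => ?_, Finset.mem_univ _⟩
      have : d = 0 := by rw [← hdist, hbe, dist_self]
      exact hdpos.ne' this
    calc W d = W (dist (blockConfig P K (e (⟨x, hx⟩, k))) (blockConfig P K b)) := by rw [hdist]
      _ ≤ siteEnergy W (blockConfig P K) (e (⟨x, hx⟩, k)) :=
        Finset.single_le_sum (f := fun b => W (dist (blockConfig P K (e (⟨x, hx⟩, k)))
          (blockConfig P K b))) (fun b hb' => hW _ (dist_pos.2 fun heq =>
            (Finset.ne_of_mem_erase hb') ((blockConfig_injective P K) heq).symm)) hba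
  -- counting deep coordinates
  have hDcard : (K : ℝ) ^ 3 - 6 * M * (K : ℝ) ^ 2 ≤ D.card := by
    have h1 := card_not_deep_le K M
    have h2 := Finset.card_filter_add_card_filter_not (s := Finset.univ)
      (p := fun k : Fin 3 → Fin K => IsDeep K M k)
    simp only [Finset.card_univ, Fintype.card_fun, Fintype.card_fin] at h2
    have h3 : (D.card : ℝ) + ((Finset.univ.filter fun k : Fin 3 → Fin K => ¬ IsDeep K M k).card : ℝ)
        = (K : ℝ) ^ 3 := by exact_mod_cast h2
    have h4 : ((Finset.univ.filter fun k : Fin 3 → Fin K => ¬ IsDeep K M k).card : ℝ) ≤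
        6 * M * (K : ℝ) ^ 2 := by exact_mod_cast h1
    linarith
  -- assemble
  calc ((K : ℝ) ^ 3 - 6 * M * (K : ℝ) ^ 2) * W d ≤ D.card * W d :=
        mul_le_mul_of_nonneg_right hDcard hWd
    _ = ∑ _a ∈ T, W d := by rw [Finset.sum_const, nsmul_eq_mul, hTcard]
    _ ≤ ∑ a ∈ T, siteEnergy W (blockConfig P K) a := Finset.sum_le_sum hrow
    _ ≤ ∑ a, siteEnergy W (blockConfig P K) a :=
        Finset.sum_le_sum_of_subset_of_nonneg (Finset.subset_univ T) fun a _ _ => hrow_nonneg a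
    _ = 2 * interactionEnergy W (blockConfig P K) := (two_mul_interactionEnergy W _).symm

/-- **COMPLEMENTARY SLACKNESS FOR THE SLACK CONE: `U = 0` on `D_P ∩ [ρ,∞)`** — for a witness,
the slack `U` vanishes at every distance `≥ ρ` realised by two points of `P` (pair counting in
blocks against the `U`-slack `o(N)`). -/
theorem U_eq_zero_of_mem_points {P : PeriodicConfiguration 3} {ρ c : ℝ} {g U f : ℝ → ℝ}
    (h : IsSplit ρ c g U f) (hv : c + f 0 / 2 ≤ -(P.energyPerParticle lennardJones))
    {p q : E3} (hp : p ∈ P.points) (hq : q ∈ P.points) (hpq : p ≠ q) :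
    U (dist p q) = 0 := by
  have hd : 0 < dist p q := dist_pos.2 hpq
  have hU0 : 0 ≤ U (dist p q) := h.U_nonneg _ hd
  refine le_antisymm (le_of_forall_pos_le_add fun ε hε => ?_) hU0
  obtain ⟨M, hM⟩ := sub_mul_le_two_mul_energy P h.U_nonneg hp hq hpq
  set F : ℝ := (P.motif.card : ℝ) with hFdef
  have hF : 0 < F := by rw [hFdef]; exact_mod_cast P.motif_nonempty.card_pos
  obtain ⟨K₀, hK₀, hK⟩ := U_slack_le h hv (show 0 < ε / (4 * F) by positivity)
  set K : ℕ := max K₀ (12 * M + 12) with hKdef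
  have h1 := hM K
  have h2 := hK K (le_max_left _ _)
  have hcard : ((Fintype.card (BIdx P K) : ℕ) : ℝ) = F * (K : ℝ) ^ 3 := by
    rw [card_BIdx]; push_cast; rw [hFdef]
  rw [hcard] at h2
  have hK12 : (12 * M + 12 : ℝ) ≤ K := by
    have : 12 * M + 12 ≤ K := le_max_right _ _
    exact_mod_cast this
  have hM0 : (0 : ℝ) ≤ M := Nat.cast_nonneg M
  have hKpos : (0 : ℝ) < K := by linarith
  have hK3 : (0 : ℝ) < (K : ℝ) ^ 3 := by positivity
  have hhalf : (K : ℝ) ^ 3 / 2 ≤ (K : ℝ) ^ 3 - 6 * M * (K : ℝ) ^ 2 := by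
    have e1 : (K : ℝ) ^ 3 - 6 * M * (K : ℝ) ^ 2 - (K : ℝ) ^ 3 / 2 =
        (K : ℝ) ^ 2 * ((K : ℝ) / 2 - 6 * M) := by ring
    have e2 : (0 : ℝ) ≤ (K : ℝ) ^ 2 * ((K : ℝ) / 2 - 6 * M) :=
      mul_nonneg (sq_nonneg _) (by linarith)
    linarith
  have h3 : (K : ℝ) ^ 3 / 2 * U (dist p q) ≤ 2 * interactionEnergy U (blockConfig P K) :=
    (mul_le_mul_of_nonneg_right hhalf hU0).trans h1
  have h4 : 2 * interactionEnergy U (blockConfig P K) ≤ ε * (K : ℝ) ^ 3 / 2 := by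
    have : ε / (4 * F) * (F * (K : ℝ) ^ 3) = ε * (K : ℝ) ^ 3 / 4 := by
      field_simp
    nlinarith [h2, this]
  have h5 : (K : ℝ) ^ 3 / 2 * U (dist p q) ≤ (K : ℝ) ^ 3 / 2 * ε := by nlinarith
  have h6 := le_of_mul_le_mul_left h5 (by positivity : (0 : ℝ) < (K : ℝ) ^ 3 / 2)
  linarith

/-- Hence **`f` INTERPOLATES `V_LJ` ON `D_P ∩ [ρ,∞)`**: `f = V_LJ` at every distance `≥ ρ`
realised in `P`, while `f ≤ V_LJ` on the whole tail (`IsSplit.f_le_tail`) — the Cohn–Kumar-type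
one-sided contact condition every witness must satisfy. -/
theorem f_eq_lennardJones_of_mem_points {P : PeriodicConfiguration 3} {ρ c : ℝ} {g U f : ℝ → ℝ}
    (h : IsSplit ρ c g U f) (hv : c + f 0 / 2 ≤ -(P.energyPerParticle lennardJones))
    {p q : E3} (hp : p ∈ P.points) (hq : q ∈ P.points) (hpq : p ≠ q) (hρ : ρ ≤ dist p q) :
    f (dist p q) = lennardJones (dist p q) := by
  rw [h.f_eq_tail hρ (dist_pos.2 hpq), U_eq_zero_of_mem_points h hv hp hq hpq, sub_zero]

/-! ### Block energies of finite-range potentials (for the `g`-slack) -/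

section FiniteRange

variable (P : PeriodicConfiguration 3) {W : ℝ → ℝ} {ρ : ℝ}

/-- A finite-range site function on a periodic configuration is finitely supported. -/
theorem finite_support_of_finRange (hW : ∀ r, ρ ≤ r → W r = 0) (p : E3) :
    (Function.support fun q : {q : E3 // q ∈ P.points ∧ q ≠ p} => W (dist p q.1)).Finite := by
  have hfin := P.finite_inter_points (Metric.isBounded_ball (x := p) (r := ρ))
  refine (hfin.preimage Subtype.val_injective.injOn).subset ?_
  intro q hq
  refine ⟨?_, q.2.1⟩
  rw [Metric.mem_ball, dist_comm]
  by_contra hle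
  exact hq (hW _ (not_lt.1 hle))

/-- Hence it is summable. -/
theorem summable_of_finRange (hW : ∀ r, ρ ≤ r → W r = 0) (p : E3) :
    Summable fun q : {q : E3 // q ∈ P.points ∧ q ≠ p} => W (dist p q.1) :=
  summable_of_hasFiniteSupport (finite_support_of_finRange P hW p)

/-- Row identity in a block: `siteSum W (bpt u) = Σ_{v ≠ u in block} W(|u − v|) + tail W u`. -/
theorem siteSum_eq_row_add_tail (hW : ∀ r, ρ ≤ r → W r = 0) (K : ℕ) (u : BIdx P K) :
    siteSum P W (bpt P K u) =
      ∑ v ∈ Finset.univ.erase u, W (dist (bpt P K u) (bpt P K v)) + tail P K W u := by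
  unfold siteSum tail
  rw [← sum_blockOthers, (summable_of_finRange P hW (bpt P K u)).sum_add_tsum_compl]

/-- Deep block points have no tail for a finite-range potential. -/
theorem tail_eq_zero_of_deep (hW : ∀ r, ρ ≤ r → W r = 0) {K : ℕ} {u : BIdx P K}
    (hdeep : IsDeep K (depth P ρ) u.2) : tail P K W u = 0 := by
  unfold tail
  have h : ∀ q : ((blockOthers P K u : Set {q : E3 // q ∈ P.points ∧ q ≠ bpt P K u})ᶜ : Set _),
      W (dist (bpt P K u) q.1.1) = 0 := fun q =>
    hW _ (le_dist_of_deep P K hdeep q.1 (by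
      have := q.2
      rwa [Set.mem_compl_iff, Finset.mem_coe] at this))
  simp only [h, tsum_zero]

/-- Every tail is bounded by the absolute site sum at the motif point. -/
theorem abs_tail_le (hW : ∀ r, ρ ≤ r → W r = 0) {K : ℕ} (u : BIdx P K) :
    |tail P K W u| ≤ siteSum P (fun r => |W r|) u.1 := by
  rw [← siteSum_bpt P K (fun r => |W r|) u]
  have hsW : Summable fun q : {q : E3 // q ∈ P.points ∧ q ≠ bpt P K u} =>
      W (dist (bpt P K u) q.1) := summable_of_finRange P hW _
  have hs : Summable fun q : {q : E3 // q ∈ P.points ∧ q ≠ bpt P K u} =>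
      |W (dist (bpt P K u) q.1)| := hsW.abs
  have h1 : |tail P K W u| ≤
      ∑' q : (((blockOthers P K u : Set {q : E3 // q ∈ P.points ∧ q ≠ bpt P K u})ᶜ :
        Set {q : E3 // q ∈ P.points ∧ q ≠ bpt P K u})), |W (dist (bpt P K u) q.1.1)| := by
    have hsub := Summable.subtype (f := fun q : {q : E3 // q ∈ P.points ∧ q ≠ bpt P K u} =>
      |W (dist (bpt P K u) q.1)|) hs
      ((blockOthers P K u : Set {q : E3 // q ∈ P.points ∧ q ≠ bpt P K u})ᶜ)
    exact norm_tsum_le_tsum_norm (E := ℝ)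
      (f := fun q : (((blockOthers P K u : Set {q : E3 // q ∈ P.points ∧ q ≠ bpt P K u})ᶜ :
        Set {q : E3 // q ∈ P.points ∧ q ≠ bpt P K u})) => W (dist (bpt P K u) q.1.1)) hsub
  have h2 := Summable.tsum_subtype_le (γ := ℝ)
    (f := fun q : {q : E3 // q ∈ P.points ∧ q ≠ bpt P K u} => |W (dist (bpt P K u) q.1)|)
    (β := ((blockOthers P K u : Set {q : E3 // q ∈ P.points ∧ q ≠ bpt P K u})ᶜ))
    (fun _ => abs_nonneg _) hs
  exact h1.trans h2

/-- The double sum over a block, re-indexed by block indices. -/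
theorem two_mul_energy_block (W : ℝ → ℝ) (K : ℕ) :
    2 * interactionEnergy W (blockConfig P K) =
      ∑ u : BIdx P K, ∑ v ∈ Finset.univ.erase u, W (dist (bpt P K u) (bpt P K v)) := by
  classical
  rw [two_mul_interactionEnergy]
  set e := Fintype.equivFin (BIdx P K) with he
  have hrow : ∀ u : BIdx P K, siteEnergy W (blockConfig P K) (e u) =
      ∑ v ∈ Finset.univ.erase u, W (dist (bpt P K u) (bpt P K v)) := by
    intro u
    unfold siteEnergy
    rw [Finset.sum_erase_eq_sub (Finset.mem_univ _), Finset.sum_erase_eq_sub (Finset.mem_univ _)]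
    simp only [blockConfig_apply, ← he, Equiv.symm_apply_apply]
    congr 1
    exact (e.symm.sum_comp (fun v => W (dist (bpt P K u) (bpt P K v))))
  rw [← e.symm.sum_comp]
  refine Finset.sum_congr rfl fun a _ => ?_
  have := hrow (e.symm a)
  rw [Equiv.apply_symm_apply] at this
  exact this

/-- **Block energy identity for a finite-range potential**:
`2E_W(block_K) = K³·2#F·e_W(P) − Σ_u tail_W(u)`, where only the `≤ 6ρ'K²·#F` non-deep
indices have non-zero tails, each bounded by an absolute site sum. -/
theorem two_mul_energy_block_eq_sub_tails (hW : ∀ r, ρ ≤ r → W r = 0) (K : ℕ) :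
    2 * interactionEnergy W (blockConfig P K) =
      (K : ℝ) ^ 3 * (2 * P.motif.card * P.energyPerParticle W) - ∑ u : BIdx P K, tail P K W u := by
  rw [two_mul_energy_block, Finset.sum_congr rfl fun u _ =>
    (eq_sub_of_add_eq (siteSum_eq_row_add_tail P hW K u).symm), Finset.sum_sub_distrib,
    ← sum_siteSum_eq, Fintype.sum_prod_type]
  simp only [siteSum_bpt, Finset.sum_const, Finset.card_univ, Fintype.card_fun, Fintype.card_fin,
    nsmul_eq_mul]
  rw [← Finset.mul_sum, Finset.sum_coe_sort P.motif (siteSum P W)]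
  push_cast
  ring

/-- The total tail is `O(K²)`: `|Σ_u tail u| ≤ 6ρ'K² · Σ_{x ∈ F} siteSum |W| x`. -/
theorem abs_sum_tail_le (hW : ∀ r, ρ ≤ r → W r = 0) (K : ℕ) :
    |∑ u : BIdx P K, tail P K W u| ≤
      6 * depth P ρ * (K : ℝ) ^ 2 * ∑ x ∈ P.motif, siteSum P (fun r => |W r|) x := by
  classical
  have hsite0 : ∀ x, 0 ≤ siteSum P (fun r => |W r|) x := fun x => tsum_nonneg fun _ => abs_nonneg _
  calc |∑ u : BIdx P K, tail P K W u|
      ≤ ∑ u : BIdx P K, |tail P K W u| := Finset.abs_sum_le_sum_abs _ _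
    _ = ∑ x : P.motif, ∑ k : Fin 3 → Fin K, |tail P K W (x, k)| := Fintype.sum_prod_type _
    _ ≤ ∑ x : P.motif, ∑ k : Fin 3 → Fin K,
          (if IsDeep K (depth P ρ) k then 0 else siteSum P (fun r => |W r|) x) := by
        refine Finset.sum_le_sum fun x _ => Finset.sum_le_sum fun k _ => ?_
        split_ifs with hk
        · rw [tail_eq_zero_of_deep P hW (u := (x, k)) hk, abs_zero]
        · exact abs_tail_le P hW (x, k)
    _ = ∑ x : P.motif, ((Finset.univ.filter fun k : Fin 3 → Fin K => ¬ IsDeep K (depth P ρ) k).card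
          : ℝ) * siteSum P (fun r => |W r|) x := by
        refine Finset.sum_congr rfl fun x _ => ?_
        rw [Finset.sum_ite, Finset.sum_const_zero, zero_add, Finset.sum_const, nsmul_eq_mul]
    _ ≤ ∑ x : P.motif, (6 * depth P ρ * (K : ℝ) ^ 2) * siteSum P (fun r => |W r|) x := by
        refine Finset.sum_le_sum fun x _ => mul_le_mul_of_nonneg_right ?_ (hsite0 x)
        exact_mod_cast card_not_deep_le K (depth P ρ)
    _ = 6 * depth P ρ * (K : ℝ) ^ 2 * ∑ x ∈ P.motif, siteSum P (fun r => |W r|) x := by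
        rw [← Finset.mul_sum, Finset.sum_coe_sort P.motif (siteSum P fun r => |W r|)]

/-- **The energy per particle of a finite-range potential is the limit of block energies**:
`|2E_W(block_K) − 2N_K e_W(P)| ≤ C·K²`. -/
theorem abs_two_mul_energy_block_sub_le (hW : ∀ r, ρ ≤ r → W r = 0) (K : ℕ) :
    |2 * interactionEnergy W (blockConfig P K) -
        (K : ℝ) ^ 3 * (2 * P.motif.card * P.energyPerParticle W)| ≤
      6 * depth P ρ * (K : ℝ) ^ 2 * ∑ x ∈ P.motif, siteSum P (fun r => |W r|) x := by
  rw [two_mul_energy_block_eq_sub_tails P hW K, sub_sub_cancel_left, abs_neg]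
  exact abs_sum_tail_le P hW K

end FiniteRange

/-- Archimedean helper: `a·K³ ≤ b·K²` for all large `K` forces `a ≤ 0`. -/
theorem nonpos_of_cubic_le_sq {a b : ℝ} (h : ∃ K₀ : ℕ, ∀ K : ℕ, K₀ ≤ K →
    a * (K : ℝ) ^ 3 ≤ b * (K : ℝ) ^ 2) : a ≤ 0 := by
  by_contra ha
  push Not at ha
  obtain ⟨K₀, hK⟩ := h
  obtain ⟨n, hn⟩ := exists_nat_gt (b / a)
  set K : ℕ := max K₀ (n + 1) with hKdef
  have h1 := hK K (le_max_left _ _)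
  have hKn : (n : ℝ) + 1 ≤ K := by
    have : n + 1 ≤ K := le_max_right _ _
    exact_mod_cast this
  have hKpos : (0 : ℝ) < K := by linarith [(Nat.cast_nonneg n : (0 : ℝ) ≤ n)]
  have h2 : a * K ≤ b := by
    have hK2 : (0 : ℝ) < (K : ℝ) ^ 2 := by positivity
    have : a * (K : ℝ) ^ 3 = (a * K) * (K : ℝ) ^ 2 := by ring
    rw [this] at h1
    exact le_of_mul_le_mul_right h1 hK2
  have h3 : b / a < K := by linarith
  rw [div_lt_iff₀ ha] at h3
  linarith [mul_comm a (K : ℝ)]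

/-- **COMPLEMENTARY SLACKNESS FOR THE FINITE-RANGE CONE: `e_g(P) = −c`** — the witness
configuration is an exact per-particle ground state of the finite-range part `g`: its `g`-energy
per particle (a finite lattice sum) equals `−c`, the stability constant of `g` over ALL finite
configurations (`−c·N ≤ E_g(x)`).  (Block identity for finite-range potentials + `g`-slack.) -/
theorem energyPerParticle_g_eq {P : PeriodicConfiguration 3} {ρ c : ℝ} {g U f : ℝ → ℝ}
    (h : IsSplit ρ c g U f) (hv : c + f 0 / 2 ≤ -(P.energyPerParticle lennardJones)) :
    P.energyPerParticle g = -c := by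
  set F : ℝ := (P.motif.card : ℝ) with hFdef
  have hF : 0 < F := by rw [hFdef]; exact_mod_cast P.motif_nonempty.card_pos
  set C : ℝ := 6 * depth P ρ * ∑ x ∈ P.motif, siteSum P (fun r => |g r|) x with hCdef
  have hblock : ∀ K : ℕ, |2 * interactionEnergy g (blockConfig P K) -
      (K : ℝ) ^ 3 * (2 * F * P.energyPerParticle g)| ≤ C * (K : ℝ) ^ 2 := by
    intro K
    have := abs_two_mul_energy_block_sub_le P h.g_zero K
    rw [hCdef]
    calc _ ≤ 6 * depth P ρ * (K : ℝ) ^ 2 * ∑ x ∈ P.motif, siteSum P (fun r => |g r|) x := this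
      _ = _ := by ring
  have hcard : ∀ K : ℕ, ((Fintype.card (BIdx P K) : ℕ) : ℝ) = F * (K : ℝ) ^ 3 := fun K => by
    rw [card_BIdx]; push_cast; rw [hFdef]
  refine le_antisymm ?_ ?_
  · -- upper bound from the `g`-slack
    have key : ∀ ε : ℝ, 0 < ε → P.energyPerParticle g + c - ε ≤ 0 := by
      intro ε hε
      obtain ⟨K₀, -, hK⟩ := g_slack_le h hv hε
      have : 2 * F * (P.energyPerParticle g + c - ε) ≤ 0 := by
        refine nonpos_of_cubic_le_sq (b := C) ⟨K₀, fun K hKK => ?_⟩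
        have h1 := hK K hKK
        rw [hcard] at h1
        have h2 := (abs_le.1 (hblock K)).1
        nlinarith [h1, h2]
      nlinarith
    have : P.energyPerParticle g + c ≤ 0 := le_of_forall_pos_le_add fun ε hε => by
      have := key ε hε; linarith
    linarith
  · -- lower bound from stability
    have : -(2 * F * (P.energyPerParticle g + c)) ≤ 0 := by
      refine nonpos_of_cubic_le_sq (b := C) ⟨0, fun K _ => ?_⟩
      have h1 := h.stable _ _ (blockConfig_injective P K)
      rw [hcard] at h1
      have h2 := (abs_le.1 (hblock K)).2
      nlinarith [h1, h2]
    nlinarith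

/-- **EVERY PERIODIC COMPETITOR'S SLACKS ARE BOUNDED BY ITS EXCESS ENERGY** (the rigorous core of the
"Barlow squeeze"): for a witness and ANY periodic configuration `Q`, along the `K`-blocks of `Q` the three
slacks satisfy eventually `(E_g + c·N) + E_U + (E_f + N·f 0/2) ≤ (e(Q) − e* + ε)·N`, each bracket `≥ 0`.
For the Barlow polytypes (`e(Q) − e* ≈ 10⁻⁴…10⁻⁵`) this forces the Bochner form of `f` to be `10⁻⁴`-small
on all stacking-dependent Bragg rods, i.e. `𝓕f` essentially band-limited to `|k| ≲ 4π/(√3·a)`, while `f`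
must still touch `V_LJ` from below at every distance of `P` beyond `ρ` (see the module docstring). -/
theorem slacks_le_of_periodic {P : PeriodicConfiguration 3} {ρ c : ℝ} {g U f : ℝ → ℝ}
    (h : IsSplit ρ c g U f) (hv : c + f 0 / 2 ≤ -(P.energyPerParticle lennardJones))
    (Q : PeriodicConfiguration 3) {ε : ℝ} (hε : 0 < ε) :
    ∃ K₀ : ℕ, 0 < K₀ ∧ ∀ K : ℕ, K₀ ≤ K →
      (interactionEnergy g (blockConfig Q K) + c * Fintype.card (BIdx Q K)) +
        interactionEnergy U (blockConfig Q K) +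
        (interactionEnergy f (blockConfig Q K) + Fintype.card (BIdx Q K) * f 0 / 2) ≤
      (Q.energyPerParticle lennardJones - eStar + ε) * Fintype.card (BIdx Q K) := by
  obtain ⟨K₀, hK₀, hK⟩ := exists_block_energy_le Q hε
  refine ⟨K₀, hK₀, fun K hKK => ?_⟩
  have h1 := hK K hKK
  rw [h.energy_eq (blockConfig_injective Q K)] at h1
  have h2 := (witness_eq h hv).2
  nlinarith [h1, h2]

/-- In particular the **Bochner slack of a competitor**: `E_f(Q_K) + N·f 0/2 ≤ (e(Q) − e* + ε)·N`
eventually — a periodic `Q` whose energy is within `δ` of the optimum has `(1/N)Σᵢⱼ f(xᵢ − xⱼ) ≤ 2δ`,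
i.e. `Σ_{G ∈ Λ_Q^*} 𝓕f(|G|)|S_Q(G)|² ≲ 2δ` in Fourier language. -/
theorem f_slack_le_of_periodic {P : PeriodicConfiguration 3} {ρ c : ℝ} {g U f : ℝ → ℝ}
    (h : IsSplit ρ c g U f) (hv : c + f 0 / 2 ≤ -(P.energyPerParticle lennardJones))
    (Q : PeriodicConfiguration 3) {ε : ℝ} (hε : 0 < ε) :
    ∃ K₀ : ℕ, 0 < K₀ ∧ ∀ K : ℕ, K₀ ≤ K →
      interactionEnergy f (blockConfig Q K) + Fintype.card (BIdx Q K) * f 0 / 2 ≤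
        (Q.energyPerParticle lennardJones - eStar + ε) * Fintype.card (BIdx Q K) := by
  obtain ⟨K₀, hK₀, hK⟩ := slacks_le_of_periodic h hv Q hε
  refine ⟨K₀, hK₀, fun K hKK => ?_⟩
  have h1 := hK K hKK
  have h2 := h.stable _ _ (blockConfig_injective Q K)
  have h3 := h.U_energy_nonneg (blockConfig_injective Q K)
  linarith

/-- … and the **finite-range slack of a competitor**: `E_g(Q_K) + c·N ≤ (e(Q) − e* + ε)·N` eventually,
whence (finite-range block identity) `e_g(Q) + c ≤ e(Q) − e*`: the finite-range part must rate every
periodic competitor within its TOTAL excess energy — for `ρ < √(8/3)·a` it rates fcc and hcp equally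
(identical pair statistics below the third shell), so then `U`- and `f`-slacks of fcc carry all of
`e(fcc) − e(hcp) ≈ 7·10⁻⁵`. -/
theorem g_excess_le_of_periodic {P : PeriodicConfiguration 3} {ρ c : ℝ} {g U f : ℝ → ℝ}
    (h : IsSplit ρ c g U f) (hv : c + f 0 / 2 ≤ -(P.energyPerParticle lennardJones))
    (Q : PeriodicConfiguration 3) :
    Q.energyPerParticle g + c ≤ Q.energyPerParticle lennardJones - eStar := by
  set F : ℝ := (Q.motif.card : ℝ) with hFdef
  have hF : 0 < F := by rw [hFdef]; exact_mod_cast Q.motif_nonempty.card_pos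
  set C : ℝ := 6 * depth Q ρ * ∑ x ∈ Q.motif, siteSum Q (fun r => |g r|) x with hCdef
  have hblock : ∀ K : ℕ, |2 * interactionEnergy g (blockConfig Q K) -
      (K : ℝ) ^ 3 * (2 * F * Q.energyPerParticle g)| ≤ C * (K : ℝ) ^ 2 := by
    intro K
    have := abs_two_mul_energy_block_sub_le Q h.g_zero K
    rw [hCdef]
    calc _ ≤ 6 * depth Q ρ * (K : ℝ) ^ 2 * ∑ x ∈ Q.motif, siteSum Q (fun r => |g r|) x := this
      _ = _ := by ring
  have hcard : ∀ K : ℕ, ((Fintype.card (BIdx Q K) : ℕ) : ℝ) = F * (K : ℝ) ^ 3 := fun K => by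
    rw [card_BIdx]; push_cast; rw [hFdef]
  set δ : ℝ := Q.energyPerParticle lennardJones - eStar with hδ
  have key : ∀ ε : ℝ, 0 < ε → Q.energyPerParticle g + c - δ - ε ≤ 0 := by
    intro ε hε
    obtain ⟨K₀, -, hK⟩ := slacks_le_of_periodic h hv Q hε
    have : 2 * F * (Q.energyPerParticle g + c - δ - ε) ≤ 0 := by
      refine nonpos_of_cubic_le_sq (b := C) ⟨K₀, fun K hKK => ?_⟩
      have h1 := hK K hKK
      have h2 := h.U_energy_nonneg (blockConfig_injective Q K)
      have h3 := h.f_energy_ge (blockConfig Q K)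
      rw [hcard] at h1 h3
      have h4 := (abs_le.1 (hblock K)).1
      nlinarith [h1, h2, h3, h4]
    nlinarith
  have : Q.energyPerParticle g + c - δ ≤ 0 := le_of_forall_pos_le_add fun ε hε => by
    have := key ε hε; linarith
  linarith

/-- For a witness the slack `U` vanishes along every site function of `P`. -/
theorem U_site_eq_zero {P : PeriodicConfiguration 3} {ρ c : ℝ} {g U f : ℝ → ℝ}
    (h : IsSplit ρ c g U f) (hv : c + f 0 / 2 ≤ -(P.energyPerParticle lennardJones))
    {x : E3} (hx : x ∈ P.points) (q : {q : E3 // q ∈ P.points ∧ q ≠ x}) :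
    U (dist x q.1) = 0 :=
  U_eq_zero_of_mem_points h hv hx q.2.1 (fun heq => q.2.2 heq.symm)

/-- Hence **`e_U(P) = 0`**. -/
theorem energyPerParticle_U_eq_zero {P : PeriodicConfiguration 3} {ρ c : ℝ} {g U f : ℝ → ℝ}
    (h : IsSplit ρ c g U f) (hv : c + f 0 / 2 ≤ -(P.energyPerParticle lennardJones)) :
    P.energyPerParticle U = 0 := by
  unfold PeriodicConfiguration.energyPerParticle
  have : ∀ x ∈ P.motif, ∑' q : {q : E3 // q ∈ P.points ∧ q ≠ x}, U (dist x q.1) = 0 := by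
    intro x hx
    have h0 : ∀ q : {q : E3 // q ∈ P.points ∧ q ≠ x}, U (dist x q.1) = 0 := fun q =>
      U_site_eq_zero h hv (P.mem_points_of_mem_motif hx) q
    simp only [h0, tsum_zero]
  rw [Finset.sum_congr rfl this]
  simp

/-- For a witness the site functions of `f` on `P` are summable: termwise
`f = V_LJ − g − U` with `U = 0` on the distances of `P`. -/
theorem summable_f_site {P : PeriodicConfiguration 3} {ρ c : ℝ} {g U f : ℝ → ℝ}
    (h : IsSplit ρ c g U f) (hv : c + f 0 / 2 ≤ -(P.energyPerParticle lennardJones))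
    {x : E3} (hx : x ∈ P.points) :
    Summable fun q : {q : E3 // q ∈ P.points ∧ q ≠ x} => f (dist x q.1) := by
  have hV := P.summable_lennardJones_dist_three x
  have hg := summable_of_finRange P h.g_zero x
  refine (hV.sub hg).congr fun q => ?_
  have hd : 0 < dist x q.1 := dist_pos.2 (fun heq => q.2.2 heq.symm)
  have h1 := h.split _ hd
  have h2 := U_site_eq_zero h hv hx q
  show lennardJones (dist x q.1) - g (dist x q.1) = f (dist x q.1)
  linarith

/-- **The periodic energy splits along the three cones**: `e(P) = e_g(P) + e_U(P) + e_f(P)`. -/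
theorem energyPerParticle_split {P : PeriodicConfiguration 3} {ρ c : ℝ} {g U f : ℝ → ℝ}
    (h : IsSplit ρ c g U f) (hv : c + f 0 / 2 ≤ -(P.energyPerParticle lennardJones)) :
    P.energyPerParticle lennardJones =
      P.energyPerParticle g + P.energyPerParticle U + P.energyPerParticle f := by
  unfold PeriodicConfiguration.energyPerParticle
  rw [← mul_add, ← mul_add, ← Finset.sum_add_distrib, ← Finset.sum_add_distrib]
  congr 1
  refine Finset.sum_congr rfl fun x hx => ?_
  have hxP := P.mem_points_of_mem_motif hx
  have hg := summable_of_finRange P h.g_zero x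
  have hU : Summable fun q : {q : E3 // q ∈ P.points ∧ q ≠ x} => U (dist x q.1) := by
    refine (summable_zero).congr fun q => ?_
    exact (U_site_eq_zero h hv hxP q).symm
  have hf := summable_f_site h hv hxP
  rw [← hg.tsum_add hU, ← (hg.add hU).tsum_add hf]
  refine tsum_congr fun q => ?_
  exact h.split _ (dist_pos.2 (fun heq => q.2.2 heq.symm))

/-- **COMPLEMENTARY SLACKNESS FOR THE BOCHNER CONE: `f 0 + 2e_f(P) = 0`** — the `P`-sum of `f`
INCLUDING the self-term vanishes (`f 0 + (#F)⁻¹ Σ_{x ∈ F} Σ_{q ∈ P, q ≠ x} f(|x − q|) = 0`):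
the witness configuration is an exact zero of the Bochner form of `f` per particle — in Fourier
language `𝓕f(0) = ∫f = 0` and `𝓕f·|S_P|² = 0` on the reciprocal lattice. -/
theorem f_zero_add_two_mul_energyPerParticle_f {P : PeriodicConfiguration 3} {ρ c : ℝ}
    {g U f : ℝ → ℝ} (h : IsSplit ρ c g U f)
    (hv : c + f 0 / 2 ≤ -(P.energyPerParticle lennardJones)) :
    f 0 + 2 * P.energyPerParticle f = 0 := by
  have h1 := energyPerParticle_split h hv
  have h2 := energyPerParticle_g_eq h hv
  have h3 := energyPerParticle_U_eq_zero h hv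
  have h4 := (witness_eq h hv).1
  have h5 := (witness_eq h hv).2
  rw [h2, h3] at h1
  linarith

/-- **SHORT RANGES ARE TWO-CONE**: if the range `ρ` is at most the minimal distance of the witness
configuration (no pair of `P` closer than `ρ`), then `e_g(P) = 0`, hence `c = 0` and `f 0/2 = −e*`:
the finite-range cone certifies nothing and the statement is the sharpness of a Bochner-type bound with
`f = V_LJ` on ALL of `D_P ∖ {0}` (by `f_eq_lennardJones_of_mem_points`).  So a witness with `c > 0` — the
only kind the route intends — needs `ρ > d_min(P)` (`ρ ≳ 0.97` for the expected hcp). -/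
theorem c_eq_zero_of_range_le_minDist {P : PeriodicConfiguration 3} {ρ c : ℝ} {g U f : ℝ → ℝ}
    (h : IsSplit ρ c g U f) (hv : c + f 0 / 2 ≤ -(P.energyPerParticle lennardJones))
    (hmin : ∀ p ∈ P.points, ∀ q ∈ P.points, p ≠ q → ρ ≤ dist p q) :
    c = 0 ∧ f 0 / 2 = -eStar := by
  have hg : P.energyPerParticle g = 0 := by
    unfold PeriodicConfiguration.energyPerParticle
    have : ∀ x ∈ P.motif, ∑' q : {q : E3 // q ∈ P.points ∧ q ≠ x}, g (dist x q.1) = 0 := by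
      intro x hx
      have h0 : ∀ q : {q : E3 // q ∈ P.points ∧ q ≠ x}, g (dist x q.1) = 0 := fun q =>
        h.g_zero _ (hmin x (P.mem_points_of_mem_motif hx) q.1 q.2.1 (fun heq => q.2.2 heq.symm))
      simp only [h0, tsum_zero]
    rw [Finset.sum_congr rfl this]
    simp
  have h1 := energyPerParticle_g_eq h hv
  have hc : c = 0 := by linarith
  refine ⟨hc, ?_⟩
  have := (witness_eq h hv).2
  rw [hc] at this
  linarith

/-- **The two-cone sub-case `ρ ≤ 0` forces `c = 0`**: then `g ≡ 0` on `(0,∞)`, the `g`-energy of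
every injective configuration vanishes, and the `g`-slack `c·N ≤ ε·N` gives `c ≤ ε` for all `ε`.
So `ExactAt ρ` with `ρ ≤ 0` says: the Fisher–Ruelle two-cone bound `E_LJ ≥ −N·f 0/2` is SHARP
(`f 0/2 = −e*`), with a periodic optimiser. -/
theorem c_eq_zero_of_rho_nonpos {P : PeriodicConfiguration 3} {ρ c : ℝ} {g U f : ℝ → ℝ}
    (h : IsSplit ρ c g U f) (hv : c + f 0 / 2 ≤ -(P.energyPerParticle lennardJones)) (hρ : ρ ≤ 0) :
    c = 0 ∧ f 0 / 2 = -eStar := by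
  have hc : c = 0 := by
    refine le_antisymm (le_of_forall_pos_le_add fun ε hε => ?_) h.c_nonneg
    obtain ⟨K₀, hK₀, hK⟩ := g_slack_le h hv hε
    have h1 := hK K₀ le_rfl
    have hg0 : interactionEnergy g (blockConfig P K₀) = 0 := by
      rw [interactionEnergy_congr_pos (W := fun _ => 0) (fun r hr => h.g_zero r (by linarith))
        (blockConfig_injective P K₀)]
      simp [interactionEnergy]
    rw [hg0, zero_add] at h1
    have hn : (0 : ℝ) < Fintype.card (BIdx P K₀) := by
      rw [card_BIdx]; exact_mod_cast Nat.mul_pos P.motif_nonempty.card_pos (pow_pos hK₀ 3)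
    have := le_of_mul_le_mul_right (by linarith : c * Fintype.card (BIdx P K₀) ≤
      ε * Fintype.card (BIdx P K₀)) hn
    linarith
  refine ⟨hc, ?_⟩
  have := (witness_eq h hv).2
  rw [hc] at this
  linarith

/-! ## §5. Variants and natural strengthenings refuted -/

/-- **No witness has `f 0 = 0`** (so none has `f ≡ 0`, nor `f ≡ 0` on the tail: the pure
"finite-range + slack" two-cone certificate `V_LJ = g + U` does not exist at any range). -/
theorem not_exact_with_f_zero_eq_zero :
    ¬ ∃ (P : PeriodicConfiguration 3) (ρ c : ℝ) (g U f : ℝ → ℝ),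
      IsSplit ρ c g U f ∧ c + f 0 / 2 = -(P.energyPerParticle lennardJones) ∧ f 0 = 0 := by
  rintro ⟨P, ρ, c, g, U, f, hs, -, hf⟩
  have := hs.f_zero_pos
  rw [hf] at this
  exact lt_irrefl _ this

/-- Even feasibility fails with `f ≡ 0`: `U = V_LJ − g = V_LJ < 0` beyond `max ρ 1`. -/
theorem not_feasible_gU_only :
    ¬ ∃ (ρ : ℝ) (g U : ℝ → ℝ), (∀ r : ℝ, 0 < r → lennardJones r = g r + U r) ∧
      (∀ r : ℝ, 0 < r → 0 ≤ U r) ∧ (∀ r : ℝ, ρ ≤ r → g r = 0) := by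
  rintro ⟨ρ, g, U, h1, h2, h3⟩
  have hr : (0 : ℝ) < max ρ 2 := lt_of_lt_of_le (by norm_num) (le_max_right _ _)
  have hV : lennardJones (max ρ 2) < 0 :=
    lennardJones_neg (lt_of_lt_of_le (by norm_num) (le_max_right _ _))
  have := h1 _ hr
  rw [h3 _ (le_max_left _ _)] at this
  have := h2 _ hr
  linarith

/-- **No witness has `c < 0`** (N = 1). -/
theorem not_exact_with_c_neg :
    ¬ ∃ (P : PeriodicConfiguration 3) (ρ c : ℝ) (g U f : ℝ → ℝ),
      IsSplit ρ c g U f ∧ c + f 0 / 2 = -(P.energyPerParticle lennardJones) ∧ c < 0 := by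
  rintro ⟨P, ρ, c, g, U, f, hs, -, hc⟩
  exact absurd hs.c_nonneg (not_le.2 hc)

/-- **No split of any kind beats the periodic infimum**: the strengthening of (S6) to
`c + f 0/2 < −e(P)` (a certificate proving MORE than the periodic energy) is false. -/
theorem not_exact_lt :
    ¬ ∃ (P : PeriodicConfiguration 3) (ρ c : ℝ) (g U f : ℝ → ℝ),
      IsSplit ρ c g U f ∧ c + f 0 / 2 < -(P.energyPerParticle lennardJones) := by
  rintro ⟨P, ρ, c, g, U, f, hs, hv⟩
  have h1 := hs.value_ge
  have h2 := eStar_le P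
  linarith

/-- **Witness ranges form an up-set**: `ExactAt ρ → ExactAt ρ'` for `ρ ≤ ρ'` (same split).  A kill
must therefore refute `ExactAt ρ` for arbitrarily LARGE `ρ`; numerics at `ρ ≤ 5/2` cannot. -/
theorem exactAt_mono {ρ ρ' : ℝ} (hρ : ρ ≤ ρ') (h : ExactAt ρ) : ExactAt ρ' := by
  obtain ⟨P, c, g, U, f, hs, hv⟩ := h
  exact ⟨P, c, g, U, f, hs.mono hρ, hv⟩

/-- The kill criterion, recorded: `¬ExactCertificate ↔ ∀ ρ, ¬ExactAt ρ`, and by monotonicity it is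
enough to refute `ExactAt` along any sequence of ranges tending to `+∞`. -/
theorem not_exactCertificate_iff_unbounded :
    ¬ ExactCertificate ↔ ∀ n : ℕ, ¬ ExactAt n := by
  rw [exactCertificate_iff_exists_exactAt, not_exists]
  refine ⟨fun h n => h n, fun h ρ hρ => ?_⟩
  obtain ⟨n, hn⟩ := exists_nat_ge ρ
  exact h n (exactAt_mono hn hρ)

end Summit.AtomisticToContinuum.Crystallization.Cruxes.ExactCertificate.Disproof

end
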